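import Literature.MathematicalPhysics.QuantumFieldTheory.Balaban1983to89.B1Eq324BenfattoKernelSect5LedgerDischargeLower
import HarnessLib

/-!
# `Balaban1983to89.B1Eq324BenfattoKernelSect5LedgerBridge` — the nI-FORM CONVERSION of the class (4.7) knit's geometric ledger
([BenfattoEtAl1978] §5 «Collecting all the errors», class road of [Balaban1985BackgroundPropagators] Sect. E)

WHY THIS MODULE (cell `pub-ymgap`, seat `dag-n08-b` gen 13; node N08 [Balaban1985UV3]).  The class (4.7) knit (seat n08-c's
`…KernelSect5LowerAssembly.exp_cumulantSum_sub_le_integral_of_ledger`, p622797; at the stopping index: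
`…KernelSect5LowerAssemblyStop.exp_cumulantSum_sub_le_integral_of_ledger_stop`) displays its errors GEOMETRICALLY — one summand per step `n` with the
counts `|J_n|`, `|Γ̄₁(B_n)|`, `|B_n|·L^d`, the cross-row price `2P_n` as two sums over the frame region, per-box errors summed over `m ∈ B_n` with the
shrink count `|shrink(m)|`, the cumulant bounds with `|J_n + τ_n|`, `|B_n|`, `|Γ̄₁(B_n)|`, and the free letters `K_u(n)`, `K₀(n)`, `ε₃₁(n)` tied to the
rows.  The ledger pack of this seat (`…KernelSect5LedgerDischargeLower.lowerpack_class`, p624670) is stated in the nI-FORM: every count replaced by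
`nI` (resp. `nI·L^d`), the price by its closed majorant `…KernelSect5LedgerPrice.two_mul_price_le_closed`, the letters by the explicit choices
`K_u := (1 + VM/(γ_A − J_c))·γc`, `K₀ := max(max 1 (1/(γ_A − J_c))) K_u`, `ε₃₁ := ε₁ + ε₂`, `|shrink| ↦ L^d`.  This file is the SOCKET between the
two (the cell bus's «socket contract (c1)(c2)(c3)», 2026-08-28): the geometric summand at cut-off `c` is `≤` the nI-form step whenever `J ≠ ∅`, `J ⊆ I`,
`|J| ≤ nI` (so that `|J + τ| ≤ nI`, `|B| ≤ nI`, `|Γ̄₁(B)| ≤ nI·L^d` by `…Sect5Eq534.card_corridorsBar_le`, every box of `B` meets `I + τ`, and `B ≠ ∅`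
for the closed price), under the corridor-width rows `1 ≤ θw`, `4J_c/γ_A ≤ (θw)²` of the pack's parameter scheme.  Summed over the `m` steps of the
stopping-index knit and with `|I_0| ≤ nI` on the Appendix-A term, the knit's `hledger` follows from any bound `E` of the nI-form ledger — in particular
from `lowerpack_class`'s `nI·errTerm S …` at `bs n = γ^n b`.

WHAT IS PROVED (two theorems, no definition, no named fact, no `sorry`; axioms standard).
* §1 ★★ `step_geometric_le_nI` — ONE STEP: geometric summand at cut-off `c` (frame `σ`, shift `τ`, data `J ⊆ I`) `≤` nI-form step at `c`.  Proof =
  term-by-term monotonicity in the counts (`…Sect5Eq534.card_corridorsBar_le`, `Finset.card_image_le`, `…Sect5Eq524.card_shrink_le` at the three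
  shrink-count positions of the per-box error, the `min 1 (·)`-power by `Real.rpow_le_rpow`) and the closed price
  `…KernelSect5LedgerPrice.two_mul_price_le_closed` with `boxes_meet_of_subset_image`; ≈ 40 atoms, no estimate of print.
* §2 ★★★ `ledger_geometric_le_nI` — THE KNIT'S LEDGER FROM THE nI-FORM LEDGER: `Σ_{n<m}(nI-form step at b_n) + nI·4·8^d·e^{−b_m²γ_A/2} ≤ E ⟹
  Σ_{n<m}(geometric summand at b_n) + |I_0|·4·8^d·e^{−b_m²γ_A/2} ≤ E` under `J_n ≠ ∅`, `J_n ⊆ I_n`, `|J_n| ≤ nI` (`n < m`), `|I_0| ≤ nI`; the left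
  member is LITERALLY `…LowerAssemblyStop`'s `hledger` with the letters substituted as above, the hypothesis LITERALLY `lowerpack_class`'s left-hand
  side at `γ^j b ↦ bs j` plus its Appendix-A term.

HONEST SCOPE / NOT HERE.  Pure count/letter bookkeeping between two landed statements of this cell (no measure, no new estimate); the choice of the
stopping index, of `nI ≥ |I_0|`, of the parameters `L, w, v, b` and the row ties of the letters (`…LedgerDischargeLower.Ku_row/K0_row/K0_ties/
eps31_row`) are the consumer's one-liners.  Count-neutral Literature helper of the class road (our class form of [BenfattoEtAl1978] §5; the port is NOT
commissioned); nothing of [Balaban1985UV3]/[Balaban1984UV2] is asserted; node N08 is NOT discharged by this file; no summit statement is proved;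
the Yang–Mills mass gap (Clay) is NOT proved by any of this.
-/

noncomputable section

open Finset
open scoped BigOperators Nat

namespace Literature.MathematicalPhysics.QuantumFieldTheory.Balaban1983to89.B1Eq324BenfattoKernelSect5LedgerBridge

open Literature.MathematicalPhysics.QuantumFieldTheory.Balaban1983to89.B1Eq324BenfattoLemma
open Literature.MathematicalPhysics.QuantumFieldTheory.Balaban1983to89.B1Eq324BenfattoSect5Boxes
open Literature.MathematicalPhysics.QuantumFieldTheory.Balaban1983to89.B1Eq324BenfattoSect5Eq511 (s1Const)
open Literature.MathematicalPhysics.QuantumFieldTheory.Balaban1983to89.B1Eq324BenfattoSect5ErrTermLedger (s1Const_nonneg)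
open Literature.MathematicalPhysics.QuantumFieldTheory.Balaban1983to89.B1Eq324BenfattoSect5Eq534 (corridorsBar card_corridorsBar_le)
open Literature.MathematicalPhysics.QuantumFieldTheory.Balaban1983to89.B1Eq324GaussianMomentLeaf (momentConst one_le_momentConst)
open Literature.Probability.LatticeModels (setPartitions)
open Literature.MathematicalPhysics.QuantumFieldTheory.Balaban1983to89.B1Eq324BenfattoSect5LedgerDischarge (sum_adm_geom_nonneg_le)
open Literature.MathematicalPhysics.QuantumFieldTheory.Balaban1983to89.B1Eq324BenfattoKernelSect5LedgerPrice
open Literature.MathematicalPhysics.QuantumFieldTheory.Balaban1983to89.B1Eq324BenfattoSect5Eq524 (card_shrink_le)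

variable {d : ℕ}

set_option maxHeartbeats 1600000 in -- ≈ 200-line closed statement + ≈ 40 monotonicity atoms (keep ≥ 2× headroom)
/-- ★★ **ONE STEP OF THE CLASS (4.7) KNIT'S GEOMETRIC LEDGER IS BELOW THE nI-FORM STEP** — at cut-off `c`, frame `σ`, shift `τ`, data `J ⊆ I` with
`J ≠ ∅` and `|J| ≤ nI`, corridor width `w` with `1 ≤ θw`, `4J_c/γ_A ≤ (θw)²`: the displayed summand of
`…KernelSect5LowerAssemblyStop.exp_cumulantSum_sub_le_integral_of_ledger_stop`'s `hledger` (letters `K_u, K₀, ε₃₁` substituted by the explicit row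
choices) is `≤` the step of `…KernelSect5LedgerDischargeLower.lowerpack_class` (counts `nI`, `nI·L^d`, closed price, `|shrink| ↦ L^d`).  Counts:
`|J + τ| ≤ |J| ≤ nI`, `|B| ≤ |J| ≤ nI` (`Finset.card_image_le`), `|Γ̄₁(B)| ≤ |B|·L^d` (`…Sect5Eq534.card_corridorsBar_le`), `|shrink(m)| ≤ L^d`
(`…Sect5Eq524.card_shrink_le`); price: `…KernelSect5LedgerPrice.two_mul_price_le_closed` (`B ≠ ∅`, every box of `B = (J+τ).image boxIndex` meets
`I + τ ⊇ J + τ` by `boxes_meet_of_subset_image`).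
[cite: BenfattoEtAl1978, §5 (5.35) p.159 «Collecting all the errors made in this process»; Balaban1985BackgroundPropagators, Sect. E p.428 (class form; ours)] -/
theorem step_geometric_le_nI {Λ J I : Finset (B1Eq324BenfattoLemma.Site d)} {τ σ : B1Eq324BenfattoLemma.Site d}
    {s D t : ℕ} {κ δ A θ Jc γA V M V₂ M₂ V₄ γ c nI : ℝ} {L w v : ℕ}
    (hκ0 : 0 ≤ κ) (hδ0 : 0 ≤ δ) (hκ' : 0 ≤ κ / 2 - δ / 2 * ((D : ℝ) ^ 2 * Real.sqrt d)) (hA : 0 ≤ A)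
    (hθ : 0 < θ) (hJc0 : 0 ≤ Jc) (hγA0 : 0 < γA) (hJcγ : Jc < γA) (hV : 0 ≤ V) (hM : 0 ≤ M) (hV₂ : 0 ≤ V₂) (hM₂ : 0 ≤ M₂) (hV₄ : 0 ≤ V₄)
    (hγ0 : 0 ≤ γ) (hc0 : 0 ≤ c) (hL : 0 < L) (hL1 : 1 ≤ (L : ℝ)) (hw : 0 < w)
    (hW1 : 1 ≤ θ * w) (hW2 : 4 * Jc / γA ≤ (θ * w) ^ 2)
    (hJne : J.Nonempty) (hJI : J ⊆ I) (hJcard : (J.card : ℝ) ≤ nI) :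
            ((s1Const s D d κ * A * c ^ D * Real.exp (-(κ / 4 * w)) * J.card
              + s1Const s D d κ * A * c ^ D *
                (Real.exp (-(κ / 4 * w)) * (corridorsBar L w v ((J.image fun x => x + τ).image (boxIndex L))).card +
                  Real.exp (-(κ / 4 * v)) * (((J.image fun x => x + τ).image (boxIndex L)).card * (L : ℝ) ^ d))
              + 2 * ((∑ y : ↥((Λ.image fun y => y - σ) \ corridors L w ((J.image fun x => x + τ).image (boxIndex L))),
                  Jc / (Real.cosh (θ * max (w : ℝ) (distToRegion (((J.image fun x => x + τ).image (boxIndex L)).biUnion (box L)) y)) - 1)) / (γA - Jc / (Real.cosh (θ * w) - 1)) +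
                ((1 + V * M / (γA - Jc) * γ) ^ 2 * c ^ 2 *
                ∑ y : ↥((Λ.image fun y => y - σ) \ corridors L w ((J.image fun x => x + τ).image (boxIndex L))),
                  Jc / (Real.cosh (θ * max (w : ℝ) (distToRegion (((J.image fun x => x + τ).image (boxIndex L)).biUnion (box L)) y)) - 1) *
                    (1 + distToRegion (I.image fun x => x + τ) y) ^ 2) / 2))
              + (∑ m ∈ ((J.image fun x => x + τ).image (boxIndex L)),
                  (2 * (2 ^ ((t + 1).choose 2) * (4 * (s1Const s D d κ * A * c ^ D * (L : ℝ) ^ d)) ^ (t + 1) / (t + 1)!) +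
                        Real.exp (2 * (4 * (s1Const s D d κ * A * c ^ D * (L : ℝ) ^ d))) *
                          (3 * (((shrink L m w).card : ℝ) * Real.exp (-(c ^ 2 / 4)))) +
                        ∑ k ∈ Finset.range t,
                          (3 ^ (k + 1) * ((∑ π ∈ setPartitions (univ : Finset (Fin (k + 1))), ((π.card - 1)! : ℝ)) *
                              (s1Const s D d κ * A * c ^ D * Real.exp (-(κ / 4 * v)) * (L : ℝ) ^ d *
                                (4 * (s1Const s D d κ * A * c ^ D * (L : ℝ) ^ d)) ^ k)) +
                            3 ^ (k + 1) * (2 ^ (k + 1) * ((∑ π ∈ setPartitions (univ : Finset (Fin (k + 1))), ((π.card - 1)! : ℝ)) *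
                                ((min 1 (2 * ((shrink L m w).card : ℝ) * Real.exp (-(c ^ 2 / 4)))) ^ ((2 * (k + 1) : ℕ) : ℝ)⁻¹ *
                                  ((1 + ((1 + V * M / (γA - Jc)) * (γ * c))) ^ D * (A * (L : ℝ) ^ d * ∑ p ∈ Finset.Icc 1 s, ((admissible p D).card : ℝ) *
                  ((2 / (1 - Real.exp (-(κ / 2 / (p : ℕ) / Real.sqrt d))) * Real.exp (κ / 2 / (p : ℕ) / Real.sqrt d)) ^ d) ^ (p - 1)) * momentConst D (2 * (k + 1)) (max (max 1 (1 / (γA - Jc))) ((1 + V * M / (γA - Jc)) * (γ * c))).toNNReal) ^ (k + 1))) +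
                              2 ^ ((k + 1) * D) * 2 ^ 2 ^ ((k + 1) * D) * (max (max 1 (1 / (γA - Jc))) ((1 + V * M / (γA - Jc)) * (γ * c))) ^ ((k + 1) * D) * Real.exp (-(δ / 2 * ((v : ℝ) + 1))) *
                                (A * Real.exp (δ / 2 * ((D : ℝ) ^ 2 * d)) * (L : ℝ) ^ d * ∑ p ∈ Finset.Icc 1 s, ((admissible p D).card : ℝ) *
                  ((2 / (1 - Real.exp (-((κ / 2 - δ / 2 * ((D : ℝ) ^ 2 * Real.sqrt d)) / (p : ℕ) / Real.sqrt d))) *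
                    Real.exp ((κ / 2 - δ / 2 * ((D : ℝ) ^ 2 * Real.sqrt d)) / (p : ℕ) / Real.sqrt d)) ^ d) ^ (p - 1)) ^ (k + 1)) +
                            3 ^ (k + 1) * (2 ^ (k + 1) * ((∑ π ∈ setPartitions (univ : Finset (Fin (k + 1))), ((π.card - 1)! : ℝ)) *
                                ((min 1 (2 * ((shrink L m w).card : ℝ) * Real.exp (-(c ^ 2 / 4)))) ^ ((2 * (k + 1) : ℕ) : ℝ)⁻¹ *
                                  ((1 + ((1 + V * M / (γA - Jc)) * (γ * c))) ^ D * (A * (L : ℝ) ^ d * ∑ p ∈ Finset.Icc 1 s, ((admissible p D).card : ℝ) *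
                  ((2 / (1 - Real.exp (-(κ / 2 / (p : ℕ) / Real.sqrt d))) * Real.exp (κ / 2 / (p : ℕ) / Real.sqrt d)) ^ d) ^ (p - 1)) * momentConst D (2 * (k + 1)) (max (max 1 (1 / (γA - Jc))) ((1 + V * M / (γA - Jc)) * (γ * c))).toNNReal) ^ (k + 1))) +
                              (A * (L : ℝ) ^ d * ∑ p ∈ Finset.Icc 1 s, ((admissible p D).card : ℝ) *
                  ((2 / (1 - Real.exp (-(κ / 2 / (p : ℕ) / Real.sqrt d))) * Real.exp (κ / 2 / (p : ℕ) / Real.sqrt d)) ^ d) ^ (p - 1)) ^ (k + 1) * (2 ^ ((k + 1) * D) * 2 ^ 2 ^ ((k + 1) * D) *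
                                ((((k + 1) * D : ℕ) : ℝ) * (max (max 1 (1 / (γA - Jc))) ((1 + V * M / (γA - Jc)) * (γ * c))) ^ ((k + 1) * D) * ((V₂ * M₂ / (γA - Jc) ^ 2 * Real.exp (-(θ / 2 * ((w - v : ℕ) : ℝ))) + Real.exp (-(θ * ((w - v : ℕ) : ℝ))) / (γA - Jc)) + M₂ / (γA - Jc) * (γ * c) * (1 + Real.sqrt d * ((L : ℝ) - 1)) * V₄ * Real.exp (-(θ / 4 * ((w - v : ℕ) : ℝ)))))))) / (k + 1)!) +
                ∑ k ∈ Finset.range t,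
              ((2 ^ (k + 1) * (2 ^ ((k + 1) * D) * 2 ^ 2 ^ ((k + 1) * D) * (max (max 1 (1 / (γA - Jc))) ((1 + V * M / (γA - Jc)) * (γ * c))) ^ ((k + 1) * D)) *
              ((A * Real.exp (δ / 2 * ((D : ℝ) ^ 2 * d)) *
                  Real.exp (-((κ / 2 - δ / 2 * ((D : ℝ) ^ 2 * Real.sqrt d)) / 2 * w))) * (J.image fun x => x + τ).card *
                ∑ p ∈ Finset.Icc 1 s, ((admissible p D).card : ℝ) *
                  ((2 / (1 - Real.exp (-((κ / 2 - δ / 2 * ((D : ℝ) ^ 2 * Real.sqrt d)) / 2 / (p : ℕ) / Real.sqrt d))) *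
                    Real.exp ((κ / 2 - δ / 2 * ((D : ℝ) ^ 2 * Real.sqrt d)) / 2 / (p : ℕ) / Real.sqrt d)) ^ d) ^ (p - 1)) *
              (A * Real.exp (δ / 2 * ((D : ℝ) ^ 2 * d)) *
                ((1 : ℝ) * (2 / (1 - Real.exp (-(δ / (2 * ((k + 1 : ℕ) : ℝ)) / Real.sqrt d))) * Real.exp (δ / (2 * ((k + 1 : ℕ) : ℝ)) / Real.sqrt d)) ^ d) *
                ∑ p ∈ Finset.Icc 1 s, ((admissible p D).card : ℝ) *
                  ((2 / (1 - Real.exp (-((κ / 2 - δ / 2 * ((D : ℝ) ^ 2 * Real.sqrt d)) / (p : ℕ) / Real.sqrt d))) *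
                    Real.exp ((κ / 2 - δ / 2 * ((D : ℝ) ^ 2 * Real.sqrt d)) / (p : ℕ) / Real.sqrt d)) ^ d) ^ (p - 1)) ^ k
              + 2 ^ (k + 1) * (2 ^ ((k + 1) * D) * 2 ^ 2 ^ ((k + 1) * D) * (max (max 1 (1 / (γA - Jc))) ((1 + V * M / (γA - Jc)) * (γ * c))) ^ ((k + 1) * D)) *
            (((J.image fun x => x + τ).image (boxIndex L)).card * (A * Real.exp (δ / 2 * ((D : ℝ) ^ 2 * d)) * Real.exp (-((κ / 2 - δ / 2 * ((D : ℝ) ^ 2 * Real.sqrt d)) / 2 * v)) *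
              (L : ℝ) ^ d * ∑ p ∈ Finset.Icc 1 s, ((admissible p D).card : ℝ) *
                  ((2 / (1 - Real.exp (-((κ / 2 - δ / 2 * ((D : ℝ) ^ 2 * Real.sqrt d)) / 2 / (p : ℕ) / Real.sqrt d))) *
                    Real.exp ((κ / 2 - δ / 2 * ((D : ℝ) ^ 2 * Real.sqrt d)) / 2 / (p : ℕ) / Real.sqrt d)) ^ d) ^ (p - 1))) *
            (A * Real.exp (δ / 2 * ((D : ℝ) ^ 2 * d)) *
              (2 / (1 - Real.exp (-(δ / (2 * ((k + 1 : ℕ) : ℝ)) / Real.sqrt d))) * Real.exp (δ / (2 * ((k + 1 : ℕ) : ℝ)) / Real.sqrt d)) ^ d *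
              ∑ p ∈ Finset.Icc 1 s, ((admissible p D).card : ℝ) *
                  ((2 / (1 - Real.exp (-((κ / 2 - δ / 2 * ((D : ℝ) ^ 2 * Real.sqrt d)) / (p : ℕ) / Real.sqrt d))) *
                    Real.exp ((κ / 2 - δ / 2 * ((D : ℝ) ^ 2 * Real.sqrt d)) / (p : ℕ) / Real.sqrt d)) ^ d) ^ (p - 1)) ^ k)
              + (2 ^ (k + 1) * (2 ^ ((k + 1) * D) * 2 ^ 2 ^ ((k + 1) * D) * (max (max 1 (1 / (γA - Jc))) ((1 + V * M / (γA - Jc)) * (γ * c))) ^ ((k + 1) * D)) *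
              (A * Real.exp (δ / 2 * ((D : ℝ) ^ 2 * d)) * Real.exp (-((κ / 2 - δ / 2 * ((D : ℝ) ^ 2 * Real.sqrt d)) / 2 * w)) *
                (corridorsBar L w v ((J.image fun x => x + τ).image (boxIndex L))).card * ∑ p ∈ Finset.Icc 1 s, ((admissible p D).card : ℝ) *
                  ((2 / (1 - Real.exp (-((κ / 2 - δ / 2 * ((D : ℝ) ^ 2 * Real.sqrt d)) / 2 / (p : ℕ) / Real.sqrt d))) *
                    Real.exp ((κ / 2 - δ / 2 * ((D : ℝ) ^ 2 * Real.sqrt d)) / 2 / (p : ℕ) / Real.sqrt d)) ^ d) ^ (p - 1)) *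
              (A * Real.exp (δ / 2 * ((D : ℝ) ^ 2 * d)) *
                (2 / (1 - Real.exp (-(δ / (2 * ((k + 1 : ℕ) : ℝ)) / Real.sqrt d))) * Real.exp (δ / (2 * ((k + 1 : ℕ) : ℝ)) / Real.sqrt d)) ^ d *
                ∑ p ∈ Finset.Icc 1 s, ((admissible p D).card : ℝ) *
                  ((2 / (1 - Real.exp (-((κ / 2 - δ / 2 * ((D : ℝ) ^ 2 * Real.sqrt d)) / (p : ℕ) / Real.sqrt d))) *
                    Real.exp ((κ / 2 - δ / 2 * ((D : ℝ) ^ 2 * Real.sqrt d)) / (p : ℕ) / Real.sqrt d)) ^ d) ^ (p - 1)) ^ k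
              + 2 ^ (k + 1) * (2 ^ ((k + 1) * D) * 2 ^ 2 ^ ((k + 1) * D) * (max (max 1 (1 / (γA - Jc))) ((1 + V * M / (γA - Jc)) * (γ * c))) ^ ((k + 1) * D)) *
            (((J.image fun x => x + τ).image (boxIndex L)).card * (A * Real.exp (δ / 2 * ((D : ℝ) ^ 2 * d)) * Real.exp (-((κ / 2 - δ / 2 * ((D : ℝ) ^ 2 * Real.sqrt d)) / 2 * v)) *
              (L : ℝ) ^ d * ∑ p ∈ Finset.Icc 1 s, ((admissible p D).card : ℝ) *
                  ((2 / (1 - Real.exp (-((κ / 2 - δ / 2 * ((D : ℝ) ^ 2 * Real.sqrt d)) / 2 / (p : ℕ) / Real.sqrt d))) *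
                    Real.exp ((κ / 2 - δ / 2 * ((D : ℝ) ^ 2 * Real.sqrt d)) / 2 / (p : ℕ) / Real.sqrt d)) ^ d) ^ (p - 1))) *
            (A * Real.exp (δ / 2 * ((D : ℝ) ^ 2 * d)) *
              (2 / (1 - Real.exp (-(δ / (2 * ((k + 1 : ℕ) : ℝ)) / Real.sqrt d))) * Real.exp (δ / (2 * ((k + 1 : ℕ) : ℝ)) / Real.sqrt d)) ^ d *
              ∑ p ∈ Finset.Icc 1 s, ((admissible p D).card : ℝ) *
                  ((2 / (1 - Real.exp (-((κ / 2 - δ / 2 * ((D : ℝ) ^ 2 * Real.sqrt d)) / (p : ℕ) / Real.sqrt d))) *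
                    Real.exp ((κ / 2 - δ / 2 * ((D : ℝ) ^ 2 * Real.sqrt d)) / (p : ℕ) / Real.sqrt d)) ^ d) ^ (p - 1)) ^ k)
              + 2 ^ ((k + 1) * D) * 2 ^ 2 ^ ((k + 1) * D) * (max (max 1 (1 / (γA - Jc))) ((1 + V * M / (γA - Jc)) * (γ * c))) ^ ((k + 1) * D) *
            (((J.image fun x => x + τ).image (boxIndex L)).card * (((k + 1 : ℕ) : ℝ) * (k : ℝ) *
              ((A * Real.exp (δ / 2 * ((D : ℝ) ^ 2 * d)) * ((L : ℝ) ^ d * (2 / (1 - Real.exp (-(δ / (2 * ((k + 1 : ℕ) : ℝ)) / Real.sqrt d))) * Real.exp (δ / (2 * ((k + 1 : ℕ) : ℝ)) / Real.sqrt d)) ^ d) *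
                  ∑ p ∈ Finset.Icc 1 s, ((admissible p D).card : ℝ) *
                  ((2 / (1 - Real.exp (-((κ / 2 - δ / 2 * ((D : ℝ) ^ 2 * Real.sqrt d)) / (p : ℕ) / Real.sqrt d))) *
                    Real.exp ((κ / 2 - δ / 2 * ((D : ℝ) ^ 2 * Real.sqrt d)) / (p : ℕ) / Real.sqrt d)) ^ d) ^ (p - 1)) * ((A * Real.exp (δ / 2 * ((D : ℝ) ^ 2 * d)) * Real.exp (-(δ / (2 * ((k + 1 : ℕ) : ℝ)) / 2 * ((w : ℝ) + v + 1))) * ((L : ℝ) ^ d * (2 / (1 - Real.exp (-(δ / (2 * ((k + 1 : ℕ) : ℝ)) / 2 / Real.sqrt d))) * Real.exp (δ / (2 * ((k + 1 : ℕ) : ℝ)) / 2 / Real.sqrt d)) ^ d) *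
                  ∑ p ∈ Finset.Icc 1 s, ((admissible p D).card : ℝ) *
                  ((2 / (1 - Real.exp (-((κ / 2 - δ / 2 * ((D : ℝ) ^ 2 * Real.sqrt d)) / (p : ℕ) / Real.sqrt d))) *
                    Real.exp ((κ / 2 - δ / 2 * ((D : ℝ) ^ 2 * Real.sqrt d)) / (p : ℕ) / Real.sqrt d)) ^ d) ^ (p - 1)) *
                 (A * Real.exp (δ / 2 * ((D : ℝ) ^ 2 * d)) * ((L : ℝ) ^ d * (2 / (1 - Real.exp (-(δ / (2 * ((k + 1 : ℕ) : ℝ)) / Real.sqrt d))) * Real.exp (δ / (2 * ((k + 1 : ℕ) : ℝ)) / Real.sqrt d)) ^ d) *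
                  ∑ p ∈ Finset.Icc 1 s, ((admissible p D).card : ℝ) *
                  ((2 / (1 - Real.exp (-((κ / 2 - δ / 2 * ((D : ℝ) ^ 2 * Real.sqrt d)) / (p : ℕ) / Real.sqrt d))) *
                    Real.exp ((κ / 2 - δ / 2 * ((D : ℝ) ^ 2 * Real.sqrt d)) / (p : ℕ) / Real.sqrt d)) ^ d) ^ (p - 1)) ^ (k - 1)))))
              + ((J.image fun x => x + τ).image (boxIndex L)).card * ((3 : ℝ) ^ (k + 1) *
            (2 ^ ((k + 1) * D) * 2 ^ 2 ^ ((k + 1) * D) * (max (max 1 (1 / (γA - Jc))) ((1 + V * M / (γA - Jc)) * (γ * c))) ^ ((k + 1) * D) *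
                Real.exp (-(δ / 2 * ((v : ℝ) + 1))) *
              (A * Real.exp (δ / 2 * ((D : ℝ) ^ 2 * d)) * (L : ℝ) ^ d * ∑ p ∈ Finset.Icc 1 s, ((admissible p D).card : ℝ) *
                  ((2 / (1 - Real.exp (-((κ / 2 - δ / 2 * ((D : ℝ) ^ 2 * Real.sqrt d)) / (p : ℕ) / Real.sqrt d))) *
                    Real.exp ((κ / 2 - δ / 2 * ((D : ℝ) ^ 2 * Real.sqrt d)) / (p : ℕ) / Real.sqrt d)) ^ d) ^ (p - 1)) ^ (k + 1)))) / (k + 1)!))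
    
      ≤
            ((s1Const s D d κ * A * c ^ D * Real.exp (-(κ / 4 * w)) * nI
              + s1Const s D d κ * A * c ^ D *
                (Real.exp (-(κ / 4 * w)) * (nI * (L : ℝ) ^ d) +
                  Real.exp (-(κ / 4 * v)) * (nI * (L : ℝ) ^ d))
              + (32 * (Jc / γA) * (2 / (1 - Real.exp (-(θ / 2 / Real.sqrt d))) * Real.exp (θ / 2 / Real.sqrt d)) ^ d +
                  8 * Jc * ((1 + V * M / (γA - Jc) * γ) ^ 2) * c ^ 2 *
                    ((2 * (1 + Real.sqrt d * ((L : ℝ) - 1)) ^ 2 + 128 / θ ^ 2) *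
                      (2 / (1 - Real.exp (-(θ / 4 / Real.sqrt d))) * Real.exp (θ / 4 / Real.sqrt d)) ^ d)) *
                (nI * (L : ℝ) ^ d) * Real.exp (-(θ * w / 2)))
              + (nI *
                  (2 * (2 ^ ((t + 1).choose 2) * (4 * (s1Const s D d κ * A * c ^ D * (L : ℝ) ^ d)) ^ (t + 1) / (t + 1)!) +
                        Real.exp (2 * (4 * (s1Const s D d κ * A * c ^ D * (L : ℝ) ^ d))) *
                          (3 * ((L : ℝ) ^ d * Real.exp (-(c ^ 2 / 4)))) +
                        ∑ k ∈ Finset.range t,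
                          (3 ^ (k + 1) * ((∑ π ∈ setPartitions (univ : Finset (Fin (k + 1))), ((π.card - 1)! : ℝ)) *
                              (s1Const s D d κ * A * c ^ D * Real.exp (-(κ / 4 * v)) * (L : ℝ) ^ d *
                                (4 * (s1Const s D d κ * A * c ^ D * (L : ℝ) ^ d)) ^ k)) +
                            3 ^ (k + 1) * (2 ^ (k + 1) * ((∑ π ∈ setPartitions (univ : Finset (Fin (k + 1))), ((π.card - 1)! : ℝ)) *
                                ((min 1 (2 * (L : ℝ) ^ d * Real.exp (-(c ^ 2 / 4)))) ^ ((2 * (k + 1) : ℕ) : ℝ)⁻¹ *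
                                  ((1 + ((1 + V * M / (γA - Jc)) * (γ * c))) ^ D * (A * (L : ℝ) ^ d * ∑ p ∈ Finset.Icc 1 s, ((admissible p D).card : ℝ) *
                  ((2 / (1 - Real.exp (-(κ / 2 / (p : ℕ) / Real.sqrt d))) * Real.exp (κ / 2 / (p : ℕ) / Real.sqrt d)) ^ d) ^ (p - 1)) * momentConst D (2 * (k + 1)) (max (max 1 (1 / (γA - Jc))) ((1 + V * M / (γA - Jc)) * (γ * c))).toNNReal) ^ (k + 1))) +
                              2 ^ ((k + 1) * D) * 2 ^ 2 ^ ((k + 1) * D) * (max (max 1 (1 / (γA - Jc))) ((1 + V * M / (γA - Jc)) * (γ * c))) ^ ((k + 1) * D) * Real.exp (-(δ / 2 * ((v : ℝ) + 1))) *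
                                (A * Real.exp (δ / 2 * ((D : ℝ) ^ 2 * d)) * (L : ℝ) ^ d * ∑ p ∈ Finset.Icc 1 s, ((admissible p D).card : ℝ) *
                  ((2 / (1 - Real.exp (-((κ / 2 - δ / 2 * ((D : ℝ) ^ 2 * Real.sqrt d)) / (p : ℕ) / Real.sqrt d))) *
                    Real.exp ((κ / 2 - δ / 2 * ((D : ℝ) ^ 2 * Real.sqrt d)) / (p : ℕ) / Real.sqrt d)) ^ d) ^ (p - 1)) ^ (k + 1)) +
                            3 ^ (k + 1) * (2 ^ (k + 1) * ((∑ π ∈ setPartitions (univ : Finset (Fin (k + 1))), ((π.card - 1)! : ℝ)) *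
                                ((min 1 (2 * (L : ℝ) ^ d * Real.exp (-(c ^ 2 / 4)))) ^ ((2 * (k + 1) : ℕ) : ℝ)⁻¹ *
                                  ((1 + ((1 + V * M / (γA - Jc)) * (γ * c))) ^ D * (A * (L : ℝ) ^ d * ∑ p ∈ Finset.Icc 1 s, ((admissible p D).card : ℝ) *
                  ((2 / (1 - Real.exp (-(κ / 2 / (p : ℕ) / Real.sqrt d))) * Real.exp (κ / 2 / (p : ℕ) / Real.sqrt d)) ^ d) ^ (p - 1)) * momentConst D (2 * (k + 1)) (max (max 1 (1 / (γA - Jc))) ((1 + V * M / (γA - Jc)) * (γ * c))).toNNReal) ^ (k + 1))) +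
                              (A * (L : ℝ) ^ d * ∑ p ∈ Finset.Icc 1 s, ((admissible p D).card : ℝ) *
                  ((2 / (1 - Real.exp (-(κ / 2 / (p : ℕ) / Real.sqrt d))) * Real.exp (κ / 2 / (p : ℕ) / Real.sqrt d)) ^ d) ^ (p - 1)) ^ (k + 1) * (2 ^ ((k + 1) * D) * 2 ^ 2 ^ ((k + 1) * D) *
                                ((((k + 1) * D : ℕ) : ℝ) * (max (max 1 (1 / (γA - Jc))) ((1 + V * M / (γA - Jc)) * (γ * c))) ^ ((k + 1) * D) * ((V₂ * M₂ / (γA - Jc) ^ 2 * Real.exp (-(θ / 2 * ((w - v : ℕ) : ℝ))) + Real.exp (-(θ * ((w - v : ℕ) : ℝ))) / (γA - Jc)) + M₂ / (γA - Jc) * (γ * c) * (1 + Real.sqrt d * ((L : ℝ) - 1)) * V₄ * Real.exp (-(θ / 4 * ((w - v : ℕ) : ℝ)))))))) / (k + 1)!) +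
                ∑ k ∈ Finset.range t,
              ((2 ^ (k + 1) * (2 ^ ((k + 1) * D) * 2 ^ 2 ^ ((k + 1) * D) * (max (max 1 (1 / (γA - Jc))) ((1 + V * M / (γA - Jc)) * (γ * c))) ^ ((k + 1) * D)) *
              ((A * Real.exp (δ / 2 * ((D : ℝ) ^ 2 * d)) *
                  Real.exp (-((κ / 2 - δ / 2 * ((D : ℝ) ^ 2 * Real.sqrt d)) / 2 * w))) * nI *
                ∑ p ∈ Finset.Icc 1 s, ((admissible p D).card : ℝ) *
                  ((2 / (1 - Real.exp (-((κ / 2 - δ / 2 * ((D : ℝ) ^ 2 * Real.sqrt d)) / 2 / (p : ℕ) / Real.sqrt d))) *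
                    Real.exp ((κ / 2 - δ / 2 * ((D : ℝ) ^ 2 * Real.sqrt d)) / 2 / (p : ℕ) / Real.sqrt d)) ^ d) ^ (p - 1)) *
              (A * Real.exp (δ / 2 * ((D : ℝ) ^ 2 * d)) *
                ((1 : ℝ) * (2 / (1 - Real.exp (-(δ / (2 * ((k + 1 : ℕ) : ℝ)) / Real.sqrt d))) * Real.exp (δ / (2 * ((k + 1 : ℕ) : ℝ)) / Real.sqrt d)) ^ d) *
                ∑ p ∈ Finset.Icc 1 s, ((admissible p D).card : ℝ) *
                  ((2 / (1 - Real.exp (-((κ / 2 - δ / 2 * ((D : ℝ) ^ 2 * Real.sqrt d)) / (p : ℕ) / Real.sqrt d))) *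
                    Real.exp ((κ / 2 - δ / 2 * ((D : ℝ) ^ 2 * Real.sqrt d)) / (p : ℕ) / Real.sqrt d)) ^ d) ^ (p - 1)) ^ k
              + 2 ^ (k + 1) * (2 ^ ((k + 1) * D) * 2 ^ 2 ^ ((k + 1) * D) * (max (max 1 (1 / (γA - Jc))) ((1 + V * M / (γA - Jc)) * (γ * c))) ^ ((k + 1) * D)) *
            (nI * (A * Real.exp (δ / 2 * ((D : ℝ) ^ 2 * d)) * Real.exp (-((κ / 2 - δ / 2 * ((D : ℝ) ^ 2 * Real.sqrt d)) / 2 * v)) *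
              (L : ℝ) ^ d * ∑ p ∈ Finset.Icc 1 s, ((admissible p D).card : ℝ) *
                  ((2 / (1 - Real.exp (-((κ / 2 - δ / 2 * ((D : ℝ) ^ 2 * Real.sqrt d)) / 2 / (p : ℕ) / Real.sqrt d))) *
                    Real.exp ((κ / 2 - δ / 2 * ((D : ℝ) ^ 2 * Real.sqrt d)) / 2 / (p : ℕ) / Real.sqrt d)) ^ d) ^ (p - 1))) *
            (A * Real.exp (δ / 2 * ((D : ℝ) ^ 2 * d)) *
              (2 / (1 - Real.exp (-(δ / (2 * ((k + 1 : ℕ) : ℝ)) / Real.sqrt d))) * Real.exp (δ / (2 * ((k + 1 : ℕ) : ℝ)) / Real.sqrt d)) ^ d *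
              ∑ p ∈ Finset.Icc 1 s, ((admissible p D).card : ℝ) *
                  ((2 / (1 - Real.exp (-((κ / 2 - δ / 2 * ((D : ℝ) ^ 2 * Real.sqrt d)) / (p : ℕ) / Real.sqrt d))) *
                    Real.exp ((κ / 2 - δ / 2 * ((D : ℝ) ^ 2 * Real.sqrt d)) / (p : ℕ) / Real.sqrt d)) ^ d) ^ (p - 1)) ^ k)
              + (2 ^ (k + 1) * (2 ^ ((k + 1) * D) * 2 ^ 2 ^ ((k + 1) * D) * (max (max 1 (1 / (γA - Jc))) ((1 + V * M / (γA - Jc)) * (γ * c))) ^ ((k + 1) * D)) *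
              (A * Real.exp (δ / 2 * ((D : ℝ) ^ 2 * d)) * Real.exp (-((κ / 2 - δ / 2 * ((D : ℝ) ^ 2 * Real.sqrt d)) / 2 * w)) *
                (nI * (L : ℝ) ^ d) * ∑ p ∈ Finset.Icc 1 s, ((admissible p D).card : ℝ) *
                  ((2 / (1 - Real.exp (-((κ / 2 - δ / 2 * ((D : ℝ) ^ 2 * Real.sqrt d)) / 2 / (p : ℕ) / Real.sqrt d))) *
                    Real.exp ((κ / 2 - δ / 2 * ((D : ℝ) ^ 2 * Real.sqrt d)) / 2 / (p : ℕ) / Real.sqrt d)) ^ d) ^ (p - 1)) *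
              (A * Real.exp (δ / 2 * ((D : ℝ) ^ 2 * d)) *
                (2 / (1 - Real.exp (-(δ / (2 * ((k + 1 : ℕ) : ℝ)) / Real.sqrt d))) * Real.exp (δ / (2 * ((k + 1 : ℕ) : ℝ)) / Real.sqrt d)) ^ d *
                ∑ p ∈ Finset.Icc 1 s, ((admissible p D).card : ℝ) *
                  ((2 / (1 - Real.exp (-((κ / 2 - δ / 2 * ((D : ℝ) ^ 2 * Real.sqrt d)) / (p : ℕ) / Real.sqrt d))) *
                    Real.exp ((κ / 2 - δ / 2 * ((D : ℝ) ^ 2 * Real.sqrt d)) / (p : ℕ) / Real.sqrt d)) ^ d) ^ (p - 1)) ^ k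
              + 2 ^ (k + 1) * (2 ^ ((k + 1) * D) * 2 ^ 2 ^ ((k + 1) * D) * (max (max 1 (1 / (γA - Jc))) ((1 + V * M / (γA - Jc)) * (γ * c))) ^ ((k + 1) * D)) *
            (nI * (A * Real.exp (δ / 2 * ((D : ℝ) ^ 2 * d)) * Real.exp (-((κ / 2 - δ / 2 * ((D : ℝ) ^ 2 * Real.sqrt d)) / 2 * v)) *
              (L : ℝ) ^ d * ∑ p ∈ Finset.Icc 1 s, ((admissible p D).card : ℝ) *
                  ((2 / (1 - Real.exp (-((κ / 2 - δ / 2 * ((D : ℝ) ^ 2 * Real.sqrt d)) / 2 / (p : ℕ) / Real.sqrt d))) *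
                    Real.exp ((κ / 2 - δ / 2 * ((D : ℝ) ^ 2 * Real.sqrt d)) / 2 / (p : ℕ) / Real.sqrt d)) ^ d) ^ (p - 1))) *
            (A * Real.exp (δ / 2 * ((D : ℝ) ^ 2 * d)) *
              (2 / (1 - Real.exp (-(δ / (2 * ((k + 1 : ℕ) : ℝ)) / Real.sqrt d))) * Real.exp (δ / (2 * ((k + 1 : ℕ) : ℝ)) / Real.sqrt d)) ^ d *
              ∑ p ∈ Finset.Icc 1 s, ((admissible p D).card : ℝ) *
                  ((2 / (1 - Real.exp (-((κ / 2 - δ / 2 * ((D : ℝ) ^ 2 * Real.sqrt d)) / (p : ℕ) / Real.sqrt d))) *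
                    Real.exp ((κ / 2 - δ / 2 * ((D : ℝ) ^ 2 * Real.sqrt d)) / (p : ℕ) / Real.sqrt d)) ^ d) ^ (p - 1)) ^ k)
              + 2 ^ ((k + 1) * D) * 2 ^ 2 ^ ((k + 1) * D) * (max (max 1 (1 / (γA - Jc))) ((1 + V * M / (γA - Jc)) * (γ * c))) ^ ((k + 1) * D) *
            (nI * (((k + 1 : ℕ) : ℝ) * (k : ℝ) *
              ((A * Real.exp (δ / 2 * ((D : ℝ) ^ 2 * d)) * ((L : ℝ) ^ d * (2 / (1 - Real.exp (-(δ / (2 * ((k + 1 : ℕ) : ℝ)) / Real.sqrt d))) * Real.exp (δ / (2 * ((k + 1 : ℕ) : ℝ)) / Real.sqrt d)) ^ d) *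
                  ∑ p ∈ Finset.Icc 1 s, ((admissible p D).card : ℝ) *
                  ((2 / (1 - Real.exp (-((κ / 2 - δ / 2 * ((D : ℝ) ^ 2 * Real.sqrt d)) / (p : ℕ) / Real.sqrt d))) *
                    Real.exp ((κ / 2 - δ / 2 * ((D : ℝ) ^ 2 * Real.sqrt d)) / (p : ℕ) / Real.sqrt d)) ^ d) ^ (p - 1)) * ((A * Real.exp (δ / 2 * ((D : ℝ) ^ 2 * d)) * Real.exp (-(δ / (2 * ((k + 1 : ℕ) : ℝ)) / 2 * ((w : ℝ) + v + 1))) * ((L : ℝ) ^ d * (2 / (1 - Real.exp (-(δ / (2 * ((k + 1 : ℕ) : ℝ)) / 2 / Real.sqrt d))) * Real.exp (δ / (2 * ((k + 1 : ℕ) : ℝ)) / 2 / Real.sqrt d)) ^ d) *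
                  ∑ p ∈ Finset.Icc 1 s, ((admissible p D).card : ℝ) *
                  ((2 / (1 - Real.exp (-((κ / 2 - δ / 2 * ((D : ℝ) ^ 2 * Real.sqrt d)) / (p : ℕ) / Real.sqrt d))) *
                    Real.exp ((κ / 2 - δ / 2 * ((D : ℝ) ^ 2 * Real.sqrt d)) / (p : ℕ) / Real.sqrt d)) ^ d) ^ (p - 1)) *
                 (A * Real.exp (δ / 2 * ((D : ℝ) ^ 2 * d)) * ((L : ℝ) ^ d * (2 / (1 - Real.exp (-(δ / (2 * ((k + 1 : ℕ) : ℝ)) / Real.sqrt d))) * Real.exp (δ / (2 * ((k + 1 : ℕ) : ℝ)) / Real.sqrt d)) ^ d) *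
                  ∑ p ∈ Finset.Icc 1 s, ((admissible p D).card : ℝ) *
                  ((2 / (1 - Real.exp (-((κ / 2 - δ / 2 * ((D : ℝ) ^ 2 * Real.sqrt d)) / (p : ℕ) / Real.sqrt d))) *
                    Real.exp ((κ / 2 - δ / 2 * ((D : ℝ) ^ 2 * Real.sqrt d)) / (p : ℕ) / Real.sqrt d)) ^ d) ^ (p - 1)) ^ (k - 1)))))
              + nI * ((3 : ℝ) ^ (k + 1) *
            (2 ^ ((k + 1) * D) * 2 ^ 2 ^ ((k + 1) * D) * (max (max 1 (1 / (γA - Jc))) ((1 + V * M / (γA - Jc)) * (γ * c))) ^ ((k + 1) * D) *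
                Real.exp (-(δ / 2 * ((v : ℝ) + 1))) *
              (A * Real.exp (δ / 2 * ((D : ℝ) ^ 2 * d)) * (L : ℝ) ^ d * ∑ p ∈ Finset.Icc 1 s, ((admissible p D).card : ℝ) *
                  ((2 / (1 - Real.exp (-((κ / 2 - δ / 2 * ((D : ℝ) ^ 2 * Real.sqrt d)) / (p : ℕ) / Real.sqrt d))) *
                    Real.exp ((κ / 2 - δ / 2 * ((D : ℝ) ^ 2 * Real.sqrt d)) / (p : ℕ) / Real.sqrt d)) ^ d) ^ (p - 1)) ^ (k + 1)))) / (k + 1)!))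
     := by
  have hs : 0 ≤ s1Const s D d κ := s1Const_nonneg s D d hκ0
  have hnI : 0 ≤ nI := le_trans (Nat.cast_nonneg _) hJcard
  have hLd : (0 : ℝ) ≤ (L : ℝ) ^ d := by positivity
  -- counts
  have hBJ : ((((J.image fun x => x + τ).image (boxIndex L)).card : ℝ)) ≤ nI :=
    le_trans (by exact_mod_cast (Finset.card_image_le.trans Finset.card_image_le)) hJcard
  have hJτ : (((J.image fun x => x + τ).card : ℝ)) ≤ nI := le_trans (by exact_mod_cast Finset.card_image_le) hJcard
  have hΓ : (((corridorsBar L w v ((J.image fun x => x + τ).image (boxIndex L))).card : ℝ)) ≤ nI * (L : ℝ) ^ d := by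
    have h1 : (((corridorsBar L w v ((J.image fun x => x + τ).image (boxIndex L))).card : ℝ)) ≤
        ((((J.image fun x => x + τ).image (boxIndex L)).card : ℝ)) * (L : ℝ) ^ d := by
      exact_mod_cast card_corridorsBar_le L w v ((J.image fun x => x + τ).image (boxIndex L))
    exact h1.trans (mul_le_mul_of_nonneg_right hBJ hLd)
  have hBL : ((((J.image fun x => x + τ).image (boxIndex L)).card : ℝ)) * (L : ℝ) ^ d ≤ nI * (L : ℝ) ^ d :=
    mul_le_mul_of_nonneg_right hBJ hLd
  refine add_le_add (add_le_add (add_le_add ?_ ?_) ?_) (add_le_add ?_ ?_)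
  · -- (e511)
    exact mul_le_mul_of_nonneg_left hJcard (by positivity)
  · -- (e534)
    exact mul_le_mul_of_nonneg_left (add_le_add (mul_le_mul_of_nonneg_left hΓ (Real.exp_pos _).le)
      (mul_le_mul_of_nonneg_left hBL (Real.exp_pos _).le)) (by positivity)
  · -- the price: closed form (needs `B ≠ ∅`, every box meets `I + τ`), then the count `|B| ≤ nI`
    have hB : ((J.image fun x => x + τ).image (boxIndex L)).Nonempty := (hJne.image _).image _
    have hBI : ∀ m ∈ (J.image fun x => x + τ).image (boxIndex L), ∃ x ∈ box L m, x ∈ I.image fun x => x + τ :=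
      boxes_meet_of_subset_image hL (Finset.image_subset_image (Finset.image_subset_image hJI))
    have h := two_mul_price_le_closed (Λ := Λ.image fun y => y - σ) (Cu := (1 + V * M / (γA - Jc) * γ) ^ 2) (c := c)
      hθ hJc0 hγA0 (sq_nonneg _) hL hw hB hBI hW1 hW2
    refine h.trans ?_
    have hV2 : 0 ≤ (2 / (1 - Real.exp (-(θ / 2 / Real.sqrt d))) * Real.exp (θ / 2 / Real.sqrt d)) ^ d :=
      pow_nonneg (mul_nonneg (div_nonneg zero_le_two (by
        have : Real.exp (-(θ / 2 / Real.sqrt d)) ≤ 1 := Real.exp_le_one_iff.mpr (by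
          have : 0 ≤ θ / 2 / Real.sqrt d := by positivity
          linarith)
        linarith)) (Real.exp_pos _).le) d
    have hV4 : 0 ≤ (2 / (1 - Real.exp (-(θ / 4 / Real.sqrt d))) * Real.exp (θ / 4 / Real.sqrt d)) ^ d :=
      pow_nonneg (mul_nonneg (div_nonneg zero_le_two (by
        have : Real.exp (-(θ / 4 / Real.sqrt d)) ≤ 1 := Real.exp_le_one_iff.mpr (by
          have : 0 ≤ θ / 4 / Real.sqrt d := by positivity
          linarith)
        linarith)) (Real.exp_pos _).le) d
    have hclosed0 : 0 ≤ 32 * (Jc / γA) * (2 / (1 - Real.exp (-(θ / 2 / Real.sqrt d))) * Real.exp (θ / 2 / Real.sqrt d)) ^ d +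
        8 * Jc * ((1 + V * M / (γA - Jc) * γ) ^ 2) * c ^ 2 *
          ((2 * (1 + Real.sqrt d * ((L : ℝ) - 1)) ^ 2 + 128 / θ ^ 2) *
            (2 / (1 - Real.exp (-(θ / 4 / Real.sqrt d))) * Real.exp (θ / 4 / Real.sqrt d)) ^ d) := by positivity
    exact mul_le_mul_of_nonneg_right (mul_le_mul_of_nonneg_left hBL hclosed0) (Real.exp_pos _).le
  · -- the per-box errors: monotone in the shrink count `|shrink| ≤ L^d` (three positions), then the count `|B| ≤ nI`
    have hgap : 0 < γA - Jc := sub_pos.mpr hJcγ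
    have hκ2 : 0 ≤ κ / 2 := by linarith
    obtain ⟨hS00, -⟩ := sum_adm_geom_nonneg_le hκ2 s D d
    obtain ⟨hS10, -⟩ := sum_adm_geom_nonneg_le hκ' s D d
    have hK0 : 0 ≤ max (max 1 (1 / (γA - Jc))) ((1 + V * M / (γA - Jc)) * (γ * c)) :=
      le_trans zero_le_one ((le_max_left _ _).trans (le_max_left _ _))
    have hKu : 0 ≤ (1 + V * M / (γA - Jc)) * (γ * c) :=
      mul_nonneg (add_nonneg zero_le_one (div_nonneg (mul_nonneg hV hM) hgap.le)) (mul_nonneg hγ0 hc0)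
    have hLm : 0 ≤ (L : ℝ) - 1 := by linarith
    have he40 : 0 ≤ Real.exp (-(c ^ 2 / 4)) := (Real.exp_pos _).le
    refine (Finset.sum_le_card_nsmul _ _
      (2 * (2 ^ ((t + 1).choose 2) * (4 * (s1Const s D d κ * A * c ^ D * (L : ℝ) ^ d)) ^ (t + 1) / (t + 1)!) +
        Real.exp (2 * (4 * (s1Const s D d κ * A * c ^ D * (L : ℝ) ^ d))) *
        (3 * ((L : ℝ) ^ d * Real.exp (-(c ^ 2 / 4)))) +
        ∑ k ∈ Finset.range t,
        (3 ^ (k + 1) * ((∑ π ∈ setPartitions (univ : Finset (Fin (k + 1))), ((π.card - 1)! : ℝ)) *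
        (s1Const s D d κ * A * c ^ D * Real.exp (-(κ / 4 * v)) * (L : ℝ) ^ d *
        (4 * (s1Const s D d κ * A * c ^ D * (L : ℝ) ^ d)) ^ k)) +
        3 ^ (k + 1) * (2 ^ (k + 1) * ((∑ π ∈ setPartitions (univ : Finset (Fin (k + 1))), ((π.card - 1)! : ℝ)) *
        ((min 1 (2 * (L : ℝ) ^ d * Real.exp (-(c ^ 2 / 4)))) ^ ((2 * (k + 1) : ℕ) : ℝ)⁻¹ *
        ((1 + ((1 + V * M / (γA - Jc)) * (γ * c))) ^ D * (A * (L : ℝ) ^ d * ∑ p ∈ Finset.Icc 1 s, ((admissible p D).card : ℝ) *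
        ((2 / (1 - Real.exp (-(κ / 2 / (p : ℕ) / Real.sqrt d))) * Real.exp (κ / 2 / (p : ℕ) / Real.sqrt d)) ^ d) ^ (p - 1)) * momentConst D (2 * (k + 1)) (max (max 1 (1 / (γA - Jc))) ((1 + V * M / (γA - Jc)) * (γ * c))).toNNReal) ^ (k + 1))) +
        2 ^ ((k + 1) * D) * 2 ^ 2 ^ ((k + 1) * D) * (max (max 1 (1 / (γA - Jc))) ((1 + V * M / (γA - Jc)) * (γ * c))) ^ ((k + 1) * D) * Real.exp (-(δ / 2 * ((v : ℝ) + 1))) *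
        (A * Real.exp (δ / 2 * ((D : ℝ) ^ 2 * d)) * (L : ℝ) ^ d * ∑ p ∈ Finset.Icc 1 s, ((admissible p D).card : ℝ) *
        ((2 / (1 - Real.exp (-((κ / 2 - δ / 2 * ((D : ℝ) ^ 2 * Real.sqrt d)) / (p : ℕ) / Real.sqrt d))) *
        Real.exp ((κ / 2 - δ / 2 * ((D : ℝ) ^ 2 * Real.sqrt d)) / (p : ℕ) / Real.sqrt d)) ^ d) ^ (p - 1)) ^ (k + 1)) +
        3 ^ (k + 1) * (2 ^ (k + 1) * ((∑ π ∈ setPartitions (univ : Finset (Fin (k + 1))), ((π.card - 1)! : ℝ)) *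
        ((min 1 (2 * (L : ℝ) ^ d * Real.exp (-(c ^ 2 / 4)))) ^ ((2 * (k + 1) : ℕ) : ℝ)⁻¹ *
        ((1 + ((1 + V * M / (γA - Jc)) * (γ * c))) ^ D * (A * (L : ℝ) ^ d * ∑ p ∈ Finset.Icc 1 s, ((admissible p D).card : ℝ) *
        ((2 / (1 - Real.exp (-(κ / 2 / (p : ℕ) / Real.sqrt d))) * Real.exp (κ / 2 / (p : ℕ) / Real.sqrt d)) ^ d) ^ (p - 1)) * momentConst D (2 * (k + 1)) (max (max 1 (1 / (γA - Jc))) ((1 + V * M / (γA - Jc)) * (γ * c))).toNNReal) ^ (k + 1))) +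
        (A * (L : ℝ) ^ d * ∑ p ∈ Finset.Icc 1 s, ((admissible p D).card : ℝ) *
        ((2 / (1 - Real.exp (-(κ / 2 / (p : ℕ) / Real.sqrt d))) * Real.exp (κ / 2 / (p : ℕ) / Real.sqrt d)) ^ d) ^ (p - 1)) ^ (k + 1) * (2 ^ ((k + 1) * D) * 2 ^ 2 ^ ((k + 1) * D) *
        ((((k + 1) * D : ℕ) : ℝ) * (max (max 1 (1 / (γA - Jc))) ((1 + V * M / (γA - Jc)) * (γ * c))) ^ ((k + 1) * D) * ((V₂ * M₂ / (γA - Jc) ^ 2 * Real.exp (-(θ / 2 * ((w - v : ℕ) : ℝ))) + Real.exp (-(θ * ((w - v : ℕ) : ℝ))) / (γA - Jc)) + M₂ / (γA - Jc) * (γ * c) * (1 + Real.sqrt d * ((L : ℝ) - 1)) * V₄ * Real.exp (-(θ / 4 * ((w - v : ℕ) : ℝ)))))))) / (k + 1)!)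
      fun m _ => ?_).trans ?_
    · -- monotonicity in the shrink count
      have hVm : ((shrink L m w).card : ℝ) ≤ (L : ℝ) ^ d := by exact_mod_cast card_shrink_le L m w
      set Vm := ((shrink L m w).card : ℝ) with hVm_def
      have hVm0 : 0 ≤ Vm := by rw [hVm_def]; exact Nat.cast_nonneg _
      set K0e := max (max 1 (1 / (γA - Jc))) ((1 + V * M / (γA - Jc)) * (γ * c)) with hK0e
      set Ku := (1 + V * M / (γA - Jc)) * (γ * c) with hKu_def
      set S0 := ∑ p ∈ Finset.Icc 1 s, ((admissible p D).card : ℝ) *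
        ((2 / (1 - Real.exp (-(κ / 2 / (p : ℕ) / Real.sqrt d))) * Real.exp (κ / 2 / (p : ℕ) / Real.sqrt d)) ^ d) ^ (p - 1) with hS0_def
      set e4 := Real.exp (-(c ^ 2 / 4)) with he4
      clear_value Vm K0e Ku S0 e4
      refine add_le_add (add_le_add le_rfl ?_) (Finset.sum_le_sum fun k _ => div_le_div_of_nonneg_right ?_ (Nat.cast_nonneg _))
      · exact mul_le_mul_of_nonneg_left (mul_le_mul_of_nonneg_left (mul_le_mul_of_nonneg_right hVm he40) zero_le_three) (Real.exp_pos _).le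
      · have hmin : (min 1 (2 * Vm * e4)) ^ (((2 * (k + 1) : ℕ) : ℝ))⁻¹ ≤ (min 1 (2 * (L : ℝ) ^ d * e4)) ^ (((2 * (k + 1) : ℕ) : ℝ))⁻¹ :=
          Real.rpow_le_rpow (le_min zero_le_one (by positivity))
            (min_le_min_left _ (mul_le_mul_of_nonneg_right (mul_le_mul_of_nonneg_left hVm zero_le_two) he40)) (by positivity)
        have hP0 : 0 ≤ ∑ π ∈ setPartitions (univ : Finset (Fin (k + 1))), ((π.card - 1)! : ℝ) :=
          Finset.sum_nonneg fun _ _ => Nat.cast_nonneg _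
        have hmc : 0 ≤ momentConst D (2 * (k + 1)) K0e.toNNReal := zero_le_one.trans (one_le_momentConst _ _ _)
        have hWk0 : 0 ≤ ((1 + Ku) ^ D * (A * (L : ℝ) ^ d * S0) * momentConst D (2 * (k + 1)) K0e.toNNReal) ^ (k + 1) :=
          pow_nonneg (mul_nonneg (mul_nonneg (pow_nonneg (by linarith) D) (mul_nonneg (mul_nonneg hA hLd) hS00)) hmc) _
        have hX : 2 ^ (k + 1) * ((∑ π ∈ setPartitions (univ : Finset (Fin (k + 1))), ((π.card - 1)! : ℝ)) *
              ((min 1 (2 * Vm * e4)) ^ (((2 * (k + 1) : ℕ) : ℝ))⁻¹ *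
                ((1 + Ku) ^ D * (A * (L : ℝ) ^ d * S0) * momentConst D (2 * (k + 1)) K0e.toNNReal) ^ (k + 1))) ≤
            2 ^ (k + 1) * ((∑ π ∈ setPartitions (univ : Finset (Fin (k + 1))), ((π.card - 1)! : ℝ)) *
              ((min 1 (2 * (L : ℝ) ^ d * e4)) ^ (((2 * (k + 1) : ℕ) : ℝ))⁻¹ *
                ((1 + Ku) ^ D * (A * (L : ℝ) ^ d * S0) * momentConst D (2 * (k + 1)) K0e.toNNReal) ^ (k + 1))) :=
          mul_le_mul_of_nonneg_left (mul_le_mul_of_nonneg_left (mul_le_mul_of_nonneg_right hmin hWk0) hP0) (by positivity)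
        exact add_le_add (add_le_add le_rfl (mul_le_mul_of_nonneg_left (add_le_add hX le_rfl) (by positivity)))
          (mul_le_mul_of_nonneg_left (add_le_add hX le_rfl) (by positivity))
    · -- the count `|B| ≤ nI` (the majorant is non-negative)
      rw [nsmul_eq_mul]
      refine mul_le_mul_of_nonneg_right hBJ ?_
      set K0e := max (max 1 (1 / (γA - Jc))) ((1 + V * M / (γA - Jc)) * (γ * c)) with hK0e
      set Ku := (1 + V * M / (γA - Jc)) * (γ * c) with hKu_def
      set S0 := ∑ p ∈ Finset.Icc 1 s, ((admissible p D).card : ℝ) *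
        ((2 / (1 - Real.exp (-(κ / 2 / (p : ℕ) / Real.sqrt d))) * Real.exp (κ / 2 / (p : ℕ) / Real.sqrt d)) ^ d) ^ (p - 1) with hS0_def
      set S1 := ∑ p ∈ Finset.Icc 1 s, ((admissible p D).card : ℝ) *
        ((2 / (1 - Real.exp (-((κ / 2 - δ / 2 * ((D : ℝ) ^ 2 * Real.sqrt d)) / (p : ℕ) / Real.sqrt d))) *
          Real.exp ((κ / 2 - δ / 2 * ((D : ℝ) ^ 2 * Real.sqrt d)) / (p : ℕ) / Real.sqrt d)) ^ d) ^ (p - 1) with hS1_def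
      set g := γA - Jc with hg_def
      set Lm := (L : ℝ) - 1 with hLm_def
      set s1 := s1Const s D d κ with hs1_def
      clear_value K0e Ku S0 S1 g Lm s1
      refine add_nonneg (add_nonneg (by positivity) (by positivity))
        (Finset.sum_nonneg fun k _ => div_nonneg ?_ (Nat.cast_nonneg _))
      have hP0 : 0 ≤ ∑ π ∈ setPartitions (univ : Finset (Fin (k + 1))), ((π.card - 1)! : ℝ) :=
        Finset.sum_nonneg fun _ _ => Nat.cast_nonneg _
      have hmc : 0 ≤ momentConst D (2 * (k + 1)) K0e.toNNReal := zero_le_one.trans (one_le_momentConst _ _ _)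
      positivity
  · -- the cumulant side: counts only (`|J+τ| ≤ nI`, `|B| ≤ nI`, `|Γ̄₁(B)| ≤ nI·L^d`)
    obtain ⟨hS10, -⟩ := sum_adm_geom_nonneg_le hκ' s D d
    have hκ'2 : 0 ≤ (κ / 2 - δ / 2 * ((D : ℝ) ^ 2 * Real.sqrt d)) / 2 := by linarith
    obtain ⟨hSw0, -⟩ := sum_adm_geom_nonneg_le hκ'2 s D d
    have hg0 : ∀ x : ℝ, 0 ≤ x → 0 ≤ 2 / (1 - Real.exp (-x)) * Real.exp x := fun x hx => by
      refine mul_nonneg (div_nonneg (by norm_num) ?_) (Real.exp_pos _).le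
      have : Real.exp (-x) ≤ 1 := Real.exp_le_one_iff.mpr (by linarith)
      linarith
    have hK0 : 0 ≤ max (max 1 (1 / (γA - Jc))) ((1 + V * M / (γA - Jc)) * (γ * c)) :=
      le_trans zero_le_one ((le_max_left _ _).trans (le_max_left _ _))
    refine Finset.sum_le_sum fun k _ => div_le_div_of_nonneg_right ?_ (Nat.cast_nonneg _)
    have hgk : 0 ≤ (2 / (1 - Real.exp (-(δ / (2 * ((k + 1 : ℕ) : ℝ)) / Real.sqrt d))) * Real.exp (δ / (2 * ((k + 1 : ℕ) : ℝ)) / Real.sqrt d)) ^ d :=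
      pow_nonneg (hg0 _ (by positivity)) d
    have hgk' : 0 ≤ (2 / (1 - Real.exp (-(δ / (2 * ((k + 1 : ℕ) : ℝ)) / 2 / Real.sqrt d))) * Real.exp (δ / (2 * ((k + 1 : ℕ) : ℝ)) / 2 / Real.sqrt d)) ^ d :=
      pow_nonneg (hg0 _ (by positivity)) d
    -- abbreviate the `k`-free and `k`-dependent atoms so that the monotonicity steps stay small
    set S1 := ∑ p ∈ Finset.Icc 1 s, ((admissible p D).card : ℝ) *
      ((2 / (1 - Real.exp (-((κ / 2 - δ / 2 * ((D : ℝ) ^ 2 * Real.sqrt d)) / (p : ℕ) / Real.sqrt d))) *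
        Real.exp ((κ / 2 - δ / 2 * ((D : ℝ) ^ 2 * Real.sqrt d)) / (p : ℕ) / Real.sqrt d)) ^ d) ^ (p - 1) with hS1
    set Sw := ∑ p ∈ Finset.Icc 1 s, ((admissible p D).card : ℝ) *
      ((2 / (1 - Real.exp (-((κ / 2 - δ / 2 * ((D : ℝ) ^ 2 * Real.sqrt d)) / 2 / (p : ℕ) / Real.sqrt d))) *
        Real.exp ((κ / 2 - δ / 2 * ((D : ℝ) ^ 2 * Real.sqrt d)) / 2 / (p : ℕ) / Real.sqrt d)) ^ d) ^ (p - 1) with hSw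
    set g := (2 / (1 - Real.exp (-(δ / (2 * ((k + 1 : ℕ) : ℝ)) / Real.sqrt d))) * Real.exp (δ / (2 * ((k + 1 : ℕ) : ℝ)) / Real.sqrt d)) ^ d with hg
    set g' := (2 / (1 - Real.exp (-(δ / (2 * ((k + 1 : ℕ) : ℝ)) / 2 / Real.sqrt d))) * Real.exp (δ / (2 * ((k + 1 : ℕ) : ℝ)) / 2 / Real.sqrt d)) ^ d with hg'
    set K0e := max (max 1 (1 / (γA - Jc))) ((1 + V * M / (γA - Jc)) * (γ * c)) with hK0e
    set E := Real.exp (δ / 2 * ((D : ℝ) ^ 2 * d)) with hE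
    have hE0 : 0 ≤ E := (Real.exp_pos _).le
    clear_value S1 Sw g g' K0e E
    refine add_le_add (add_le_add (add_le_add (add_le_add ?_ ?_) (add_le_add ?_ ?_)) ?_) ?_
    · -- (a): `|J + τ| ≤ nI`
      refine mul_le_mul_of_nonneg_right ?_ (by positivity)
      refine mul_le_mul_of_nonneg_left ?_ (by positivity)
      refine mul_le_mul_of_nonneg_right ?_ hSw0
      exact mul_le_mul_of_nonneg_left hJτ (by positivity)
    · -- (b): `|B| ≤ nI`
      refine mul_le_mul_of_nonneg_right ?_ (by positivity)
      refine mul_le_mul_of_nonneg_left ?_ (by positivity)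
      exact mul_le_mul_of_nonneg_right hBJ (by positivity)
    · -- (c): `|Γ̄₁(B)| ≤ nI·L^d`
      refine mul_le_mul_of_nonneg_right ?_ (by positivity)
      refine mul_le_mul_of_nonneg_left ?_ (by positivity)
      refine mul_le_mul_of_nonneg_right ?_ hSw0
      exact mul_le_mul_of_nonneg_left hΓ (by positivity)
    · -- (d) = (b)
      refine mul_le_mul_of_nonneg_right ?_ (by positivity)
      refine mul_le_mul_of_nonneg_left ?_ (by positivity)
      exact mul_le_mul_of_nonneg_right hBJ (by positivity)
    · -- (e) CROSS: `|B| ≤ nI`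
      refine mul_le_mul_of_nonneg_left ?_ (by positivity)
      exact mul_le_mul_of_nonneg_right hBJ (by positivity)
    · -- (f) W₂₉: `|B| ≤ nI`
      exact mul_le_mul_of_nonneg_right hBJ (by positivity)

set_option maxHeartbeats 1600000 in -- two ≈ 100-line closed ledger texts in the statement (elaboration alone exceeds the default)
/-- **THE GEOMETRIC LEDGER OF THE CLASS (4.7) KNIT AT THE STOPPING INDEX IS BELOW ITS nI-FORM** — summing `step_geometric_le_nI` over the
`m` steps (`J_n ≠ ∅`, `J_n ⊆ I_n`, `|J_n| ≤ nI` for `n < m`) and paying the Appendix-A term with `|I_0| ≤ nI`: if the nI-form ledger (the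
left-hand side of `…KernelSect5LedgerDischargeLower.lowerpack_class` at the cut-offs `bs n`, plus `nI·4·8^d·e^{−b_m²/(2/γ_A)}`) is `≤ E`, then so
is the knit's displayed ledger (`…KernelSect5LowerAssemblyStop.exp_cumulantSum_sub_le_integral_of_ledger_stop`'s `hledger` with the letters
`Ku n := (1 + VM/(γ_A − J_c))·γ b_n`, `K₀ n := max(max 1 (1/(γ_A − J_c))) (Ku n)`, `ε₃₁ n := ε₁ + ε₂(b_n)`).  Socket contract (c1)–(c3) of the
cell bus, 2026-08-28: counts → nI, closed price, letters substituted.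
[cite: BenfattoEtAl1978, §5 (5.35) p.159 «Collecting all the errors made in this process»; Balaban1985BackgroundPropagators, Sect. E p.428 (class form; ours)] -/
theorem ledger_geometric_le_nI {Λ : Finset (B1Eq324BenfattoLemma.Site d)} {Js Is : ℕ → Finset (B1Eq324BenfattoLemma.Site d)}
    {τ σ : ℕ → B1Eq324BenfattoLemma.Site d} {bs : ℕ → ℝ} {m s D t : ℕ} {κ δ Ac θ Jc γA V M V₂ M₂ V₄ γ nI E : ℝ} {L w v : ℕ}
    (hκ0 : 0 ≤ κ) (hδ0 : 0 ≤ δ) (hκ' : 0 ≤ κ / 2 - δ / 2 * ((D : ℝ) ^ 2 * Real.sqrt d)) (hA : 0 ≤ Ac)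
    (hθ : 0 < θ) (hJc0 : 0 ≤ Jc) (hγA0 : 0 < γA) (hJcγ : Jc < γA) (hV : 0 ≤ V) (hM : 0 ≤ M) (hV₂ : 0 ≤ V₂) (hM₂ : 0 ≤ M₂) (hV₄ : 0 ≤ V₄)
    (hγ0 : 0 ≤ γ) (hb0 : ∀ n < m, 0 ≤ bs n) (hL : 0 < L) (hL1 : 1 ≤ (L : ℝ)) (hw : 0 < w)
    (hW1 : 1 ≤ θ * w) (hW2 : 4 * Jc / γA ≤ (θ * w) ^ 2)
    (hJne : ∀ n < m, (Js n).Nonempty) (hJI : ∀ n < m, Js n ⊆ Is n) (hJcard : ∀ n < m, ((Js n).card : ℝ) ≤ nI)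
    (hI : ((Is 0).card : ℝ) ≤ nI)
    (hpack : ∑ n ∈ Finset.range m,
        ((s1Const s D d κ * Ac * bs n ^ D * Real.exp (-(κ / 4 * w)) * nI
          + s1Const s D d κ * Ac * bs n ^ D *
            (Real.exp (-(κ / 4 * w)) * (nI * (L : ℝ) ^ d) +
              Real.exp (-(κ / 4 * v)) * (nI * (L : ℝ) ^ d))
          + (32 * (Jc / γA) * (2 / (1 - Real.exp (-(θ / 2 / Real.sqrt d))) * Real.exp (θ / 2 / Real.sqrt d)) ^ d +
              8 * Jc * ((1 + V * M / (γA - Jc) * γ) ^ 2) * bs n ^ 2 *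
                ((2 * (1 + Real.sqrt d * ((L : ℝ) - 1)) ^ 2 + 128 / θ ^ 2) *
                  (2 / (1 - Real.exp (-(θ / 4 / Real.sqrt d))) * Real.exp (θ / 4 / Real.sqrt d)) ^ d)) *
            (nI * (L : ℝ) ^ d) * Real.exp (-(θ * w / 2)))
          + (nI *
              (2 * (2 ^ ((t + 1).choose 2) * (4 * (s1Const s D d κ * Ac * bs n ^ D * (L : ℝ) ^ d)) ^ (t + 1) / (t + 1)!) +
                    Real.exp (2 * (4 * (s1Const s D d κ * Ac * bs n ^ D * (L : ℝ) ^ d))) *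
                      (3 * ((L : ℝ) ^ d * Real.exp (-(bs n ^ 2 / 4)))) +
                    ∑ k ∈ Finset.range t,
                      (3 ^ (k + 1) * ((∑ π ∈ setPartitions (univ : Finset (Fin (k + 1))), ((π.card - 1)! : ℝ)) *
                          (s1Const s D d κ * Ac * bs n ^ D * Real.exp (-(κ / 4 * v)) * (L : ℝ) ^ d *
                            (4 * (s1Const s D d κ * Ac * bs n ^ D * (L : ℝ) ^ d)) ^ k)) +
                        3 ^ (k + 1) * (2 ^ (k + 1) * ((∑ π ∈ setPartitions (univ : Finset (Fin (k + 1))), ((π.card - 1)! : ℝ)) *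
                            ((min 1 (2 * (L : ℝ) ^ d * Real.exp (-(bs n ^ 2 / 4)))) ^ ((2 * (k + 1) : ℕ) : ℝ)⁻¹ *
                              ((1 + ((1 + V * M / (γA - Jc)) * (γ * bs n))) ^ D * (Ac * (L : ℝ) ^ d * ∑ p ∈ Finset.Icc 1 s, ((admissible p D).card : ℝ) *
              ((2 / (1 - Real.exp (-(κ / 2 / (p : ℕ) / Real.sqrt d))) * Real.exp (κ / 2 / (p : ℕ) / Real.sqrt d)) ^ d) ^ (p - 1)) * momentConst D (2 * (k + 1)) (max (max 1 (1 / (γA - Jc))) ((1 + V * M / (γA - Jc)) * (γ * bs n))).toNNReal) ^ (k + 1))) +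
                          2 ^ ((k + 1) * D) * 2 ^ 2 ^ ((k + 1) * D) * (max (max 1 (1 / (γA - Jc))) ((1 + V * M / (γA - Jc)) * (γ * bs n))) ^ ((k + 1) * D) * Real.exp (-(δ / 2 * ((v : ℝ) + 1))) *
                            (Ac * Real.exp (δ / 2 * ((D : ℝ) ^ 2 * d)) * (L : ℝ) ^ d * ∑ p ∈ Finset.Icc 1 s, ((admissible p D).card : ℝ) *
              ((2 / (1 - Real.exp (-((κ / 2 - δ / 2 * ((D : ℝ) ^ 2 * Real.sqrt d)) / (p : ℕ) / Real.sqrt d))) *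
                Real.exp ((κ / 2 - δ / 2 * ((D : ℝ) ^ 2 * Real.sqrt d)) / (p : ℕ) / Real.sqrt d)) ^ d) ^ (p - 1)) ^ (k + 1)) +
                        3 ^ (k + 1) * (2 ^ (k + 1) * ((∑ π ∈ setPartitions (univ : Finset (Fin (k + 1))), ((π.card - 1)! : ℝ)) *
                            ((min 1 (2 * (L : ℝ) ^ d * Real.exp (-(bs n ^ 2 / 4)))) ^ ((2 * (k + 1) : ℕ) : ℝ)⁻¹ *
                              ((1 + ((1 + V * M / (γA - Jc)) * (γ * bs n))) ^ D * (Ac * (L : ℝ) ^ d * ∑ p ∈ Finset.Icc 1 s, ((admissible p D).card : ℝ) *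
              ((2 / (1 - Real.exp (-(κ / 2 / (p : ℕ) / Real.sqrt d))) * Real.exp (κ / 2 / (p : ℕ) / Real.sqrt d)) ^ d) ^ (p - 1)) * momentConst D (2 * (k + 1)) (max (max 1 (1 / (γA - Jc))) ((1 + V * M / (γA - Jc)) * (γ * bs n))).toNNReal) ^ (k + 1))) +
                          (Ac * (L : ℝ) ^ d * ∑ p ∈ Finset.Icc 1 s, ((admissible p D).card : ℝ) *
              ((2 / (1 - Real.exp (-(κ / 2 / (p : ℕ) / Real.sqrt d))) * Real.exp (κ / 2 / (p : ℕ) / Real.sqrt d)) ^ d) ^ (p - 1)) ^ (k + 1) * (2 ^ ((k + 1) * D) * 2 ^ 2 ^ ((k + 1) * D) *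
                            ((((k + 1) * D : ℕ) : ℝ) * (max (max 1 (1 / (γA - Jc))) ((1 + V * M / (γA - Jc)) * (γ * bs n))) ^ ((k + 1) * D) * ((V₂ * M₂ / (γA - Jc) ^ 2 * Real.exp (-(θ / 2 * ((w - v : ℕ) : ℝ))) + Real.exp (-(θ * ((w - v : ℕ) : ℝ))) / (γA - Jc)) + M₂ / (γA - Jc) * (γ * bs n) * (1 + Real.sqrt d * ((L : ℝ) - 1)) * V₄ * Real.exp (-(θ / 4 * ((w - v : ℕ) : ℝ)))))))) / (k + 1)!) +
            ∑ k ∈ Finset.range t,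
          ((2 ^ (k + 1) * (2 ^ ((k + 1) * D) * 2 ^ 2 ^ ((k + 1) * D) * (max (max 1 (1 / (γA - Jc))) ((1 + V * M / (γA - Jc)) * (γ * bs n))) ^ ((k + 1) * D)) *
          ((Ac * Real.exp (δ / 2 * ((D : ℝ) ^ 2 * d)) *
              Real.exp (-((κ / 2 - δ / 2 * ((D : ℝ) ^ 2 * Real.sqrt d)) / 2 * w))) * nI *
            ∑ p ∈ Finset.Icc 1 s, ((admissible p D).card : ℝ) *
              ((2 / (1 - Real.exp (-((κ / 2 - δ / 2 * ((D : ℝ) ^ 2 * Real.sqrt d)) / 2 / (p : ℕ) / Real.sqrt d))) *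
                Real.exp ((κ / 2 - δ / 2 * ((D : ℝ) ^ 2 * Real.sqrt d)) / 2 / (p : ℕ) / Real.sqrt d)) ^ d) ^ (p - 1)) *
          (Ac * Real.exp (δ / 2 * ((D : ℝ) ^ 2 * d)) *
            ((1 : ℝ) * (2 / (1 - Real.exp (-(δ / (2 * ((k + 1 : ℕ) : ℝ)) / Real.sqrt d))) * Real.exp (δ / (2 * ((k + 1 : ℕ) : ℝ)) / Real.sqrt d)) ^ d) *
            ∑ p ∈ Finset.Icc 1 s, ((admissible p D).card : ℝ) *
              ((2 / (1 - Real.exp (-((κ / 2 - δ / 2 * ((D : ℝ) ^ 2 * Real.sqrt d)) / (p : ℕ) / Real.sqrt d))) *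
                Real.exp ((κ / 2 - δ / 2 * ((D : ℝ) ^ 2 * Real.sqrt d)) / (p : ℕ) / Real.sqrt d)) ^ d) ^ (p - 1)) ^ k
          + 2 ^ (k + 1) * (2 ^ ((k + 1) * D) * 2 ^ 2 ^ ((k + 1) * D) * (max (max 1 (1 / (γA - Jc))) ((1 + V * M / (γA - Jc)) * (γ * bs n))) ^ ((k + 1) * D)) *
        (nI * (Ac * Real.exp (δ / 2 * ((D : ℝ) ^ 2 * d)) * Real.exp (-((κ / 2 - δ / 2 * ((D : ℝ) ^ 2 * Real.sqrt d)) / 2 * v)) *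
          (L : ℝ) ^ d * ∑ p ∈ Finset.Icc 1 s, ((admissible p D).card : ℝ) *
              ((2 / (1 - Real.exp (-((κ / 2 - δ / 2 * ((D : ℝ) ^ 2 * Real.sqrt d)) / 2 / (p : ℕ) / Real.sqrt d))) *
                Real.exp ((κ / 2 - δ / 2 * ((D : ℝ) ^ 2 * Real.sqrt d)) / 2 / (p : ℕ) / Real.sqrt d)) ^ d) ^ (p - 1))) *
        (Ac * Real.exp (δ / 2 * ((D : ℝ) ^ 2 * d)) *
          (2 / (1 - Real.exp (-(δ / (2 * ((k + 1 : ℕ) : ℝ)) / Real.sqrt d))) * Real.exp (δ / (2 * ((k + 1 : ℕ) : ℝ)) / Real.sqrt d)) ^ d *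
          ∑ p ∈ Finset.Icc 1 s, ((admissible p D).card : ℝ) *
              ((2 / (1 - Real.exp (-((κ / 2 - δ / 2 * ((D : ℝ) ^ 2 * Real.sqrt d)) / (p : ℕ) / Real.sqrt d))) *
                Real.exp ((κ / 2 - δ / 2 * ((D : ℝ) ^ 2 * Real.sqrt d)) / (p : ℕ) / Real.sqrt d)) ^ d) ^ (p - 1)) ^ k)
          + (2 ^ (k + 1) * (2 ^ ((k + 1) * D) * 2 ^ 2 ^ ((k + 1) * D) * (max (max 1 (1 / (γA - Jc))) ((1 + V * M / (γA - Jc)) * (γ * bs n))) ^ ((k + 1) * D)) *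
          (Ac * Real.exp (δ / 2 * ((D : ℝ) ^ 2 * d)) * Real.exp (-((κ / 2 - δ / 2 * ((D : ℝ) ^ 2 * Real.sqrt d)) / 2 * w)) *
            (nI * (L : ℝ) ^ d) * ∑ p ∈ Finset.Icc 1 s, ((admissible p D).card : ℝ) *
              ((2 / (1 - Real.exp (-((κ / 2 - δ / 2 * ((D : ℝ) ^ 2 * Real.sqrt d)) / 2 / (p : ℕ) / Real.sqrt d))) *
                Real.exp ((κ / 2 - δ / 2 * ((D : ℝ) ^ 2 * Real.sqrt d)) / 2 / (p : ℕ) / Real.sqrt d)) ^ d) ^ (p - 1)) *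
          (Ac * Real.exp (δ / 2 * ((D : ℝ) ^ 2 * d)) *
            (2 / (1 - Real.exp (-(δ / (2 * ((k + 1 : ℕ) : ℝ)) / Real.sqrt d))) * Real.exp (δ / (2 * ((k + 1 : ℕ) : ℝ)) / Real.sqrt d)) ^ d *
            ∑ p ∈ Finset.Icc 1 s, ((admissible p D).card : ℝ) *
              ((2 / (1 - Real.exp (-((κ / 2 - δ / 2 * ((D : ℝ) ^ 2 * Real.sqrt d)) / (p : ℕ) / Real.sqrt d))) *
                Real.exp ((κ / 2 - δ / 2 * ((D : ℝ) ^ 2 * Real.sqrt d)) / (p : ℕ) / Real.sqrt d)) ^ d) ^ (p - 1)) ^ k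
          + 2 ^ (k + 1) * (2 ^ ((k + 1) * D) * 2 ^ 2 ^ ((k + 1) * D) * (max (max 1 (1 / (γA - Jc))) ((1 + V * M / (γA - Jc)) * (γ * bs n))) ^ ((k + 1) * D)) *
        (nI * (Ac * Real.exp (δ / 2 * ((D : ℝ) ^ 2 * d)) * Real.exp (-((κ / 2 - δ / 2 * ((D : ℝ) ^ 2 * Real.sqrt d)) / 2 * v)) *
          (L : ℝ) ^ d * ∑ p ∈ Finset.Icc 1 s, ((admissible p D).card : ℝ) *
              ((2 / (1 - Real.exp (-((κ / 2 - δ / 2 * ((D : ℝ) ^ 2 * Real.sqrt d)) / 2 / (p : ℕ) / Real.sqrt d))) *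
                Real.exp ((κ / 2 - δ / 2 * ((D : ℝ) ^ 2 * Real.sqrt d)) / 2 / (p : ℕ) / Real.sqrt d)) ^ d) ^ (p - 1))) *
        (Ac * Real.exp (δ / 2 * ((D : ℝ) ^ 2 * d)) *
          (2 / (1 - Real.exp (-(δ / (2 * ((k + 1 : ℕ) : ℝ)) / Real.sqrt d))) * Real.exp (δ / (2 * ((k + 1 : ℕ) : ℝ)) / Real.sqrt d)) ^ d *
          ∑ p ∈ Finset.Icc 1 s, ((admissible p D).card : ℝ) *
              ((2 / (1 - Real.exp (-((κ / 2 - δ / 2 * ((D : ℝ) ^ 2 * Real.sqrt d)) / (p : ℕ) / Real.sqrt d))) *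
                Real.exp ((κ / 2 - δ / 2 * ((D : ℝ) ^ 2 * Real.sqrt d)) / (p : ℕ) / Real.sqrt d)) ^ d) ^ (p - 1)) ^ k)
          + 2 ^ ((k + 1) * D) * 2 ^ 2 ^ ((k + 1) * D) * (max (max 1 (1 / (γA - Jc))) ((1 + V * M / (γA - Jc)) * (γ * bs n))) ^ ((k + 1) * D) *
        (nI * (((k + 1 : ℕ) : ℝ) * (k : ℝ) *
          ((Ac * Real.exp (δ / 2 * ((D : ℝ) ^ 2 * d)) * ((L : ℝ) ^ d * (2 / (1 - Real.exp (-(δ / (2 * ((k + 1 : ℕ) : ℝ)) / Real.sqrt d))) * Real.exp (δ / (2 * ((k + 1 : ℕ) : ℝ)) / Real.sqrt d)) ^ d) *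
              ∑ p ∈ Finset.Icc 1 s, ((admissible p D).card : ℝ) *
              ((2 / (1 - Real.exp (-((κ / 2 - δ / 2 * ((D : ℝ) ^ 2 * Real.sqrt d)) / (p : ℕ) / Real.sqrt d))) *
                Real.exp ((κ / 2 - δ / 2 * ((D : ℝ) ^ 2 * Real.sqrt d)) / (p : ℕ) / Real.sqrt d)) ^ d) ^ (p - 1)) * ((Ac * Real.exp (δ / 2 * ((D : ℝ) ^ 2 * d)) * Real.exp (-(δ / (2 * ((k + 1 : ℕ) : ℝ)) / 2 * ((w : ℝ) + v + 1))) * ((L : ℝ) ^ d * (2 / (1 - Real.exp (-(δ / (2 * ((k + 1 : ℕ) : ℝ)) / 2 / Real.sqrt d))) * Real.exp (δ / (2 * ((k + 1 : ℕ) : ℝ)) / 2 / Real.sqrt d)) ^ d) *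
              ∑ p ∈ Finset.Icc 1 s, ((admissible p D).card : ℝ) *
              ((2 / (1 - Real.exp (-((κ / 2 - δ / 2 * ((D : ℝ) ^ 2 * Real.sqrt d)) / (p : ℕ) / Real.sqrt d))) *
                Real.exp ((κ / 2 - δ / 2 * ((D : ℝ) ^ 2 * Real.sqrt d)) / (p : ℕ) / Real.sqrt d)) ^ d) ^ (p - 1)) *
             (Ac * Real.exp (δ / 2 * ((D : ℝ) ^ 2 * d)) * ((L : ℝ) ^ d * (2 / (1 - Real.exp (-(δ / (2 * ((k + 1 : ℕ) : ℝ)) / Real.sqrt d))) * Real.exp (δ / (2 * ((k + 1 : ℕ) : ℝ)) / Real.sqrt d)) ^ d) *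
              ∑ p ∈ Finset.Icc 1 s, ((admissible p D).card : ℝ) *
              ((2 / (1 - Real.exp (-((κ / 2 - δ / 2 * ((D : ℝ) ^ 2 * Real.sqrt d)) / (p : ℕ) / Real.sqrt d))) *
                Real.exp ((κ / 2 - δ / 2 * ((D : ℝ) ^ 2 * Real.sqrt d)) / (p : ℕ) / Real.sqrt d)) ^ d) ^ (p - 1)) ^ (k - 1)))))
          + nI * ((3 : ℝ) ^ (k + 1) *
        (2 ^ ((k + 1) * D) * 2 ^ 2 ^ ((k + 1) * D) * (max (max 1 (1 / (γA - Jc))) ((1 + V * M / (γA - Jc)) * (γ * bs n))) ^ ((k + 1) * D) *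
            Real.exp (-(δ / 2 * ((v : ℝ) + 1))) *
          (Ac * Real.exp (δ / 2 * ((D : ℝ) ^ 2 * d)) * (L : ℝ) ^ d * ∑ p ∈ Finset.Icc 1 s, ((admissible p D).card : ℝ) *
              ((2 / (1 - Real.exp (-((κ / 2 - δ / 2 * ((D : ℝ) ^ 2 * Real.sqrt d)) / (p : ℕ) / Real.sqrt d))) *
                Real.exp ((κ / 2 - δ / 2 * ((D : ℝ) ^ 2 * Real.sqrt d)) / (p : ℕ) / Real.sqrt d)) ^ d) ^ (p - 1)) ^ (k + 1)))) / (k + 1)!))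
        + nI * (4 * 8 ^ d * Real.exp (-(bs m ^ 2 / (2 * (1 / γA))))) ≤ E) :
    ∑ n ∈ Finset.range m,
        ((s1Const s D d κ * Ac * bs n ^ D * Real.exp (-(κ / 4 * w)) * (Js n).card
          + s1Const s D d κ * Ac * bs n ^ D *
            (Real.exp (-(κ / 4 * w)) * (corridorsBar L w v (((Js n).image fun x => x + τ n).image (boxIndex L))).card +
              Real.exp (-(κ / 4 * v)) * ((((Js n).image fun x => x + τ n).image (boxIndex L)).card * (L : ℝ) ^ d))
          + 2 * ((∑ y : ↥((Λ.image fun y => y - σ (n + 1)) \ corridors L w (((Js n).image fun x => x + τ n).image (boxIndex L))),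
              Jc / (Real.cosh (θ * max (w : ℝ) (distToRegion ((((Js n).image fun x => x + τ n).image (boxIndex L)).biUnion (box L)) y)) - 1)) / (γA - Jc / (Real.cosh (θ * w) - 1)) +
            ((1 + V * M / (γA - Jc) * γ) ^ 2 * bs n ^ 2 *
            ∑ y : ↥((Λ.image fun y => y - σ (n + 1)) \ corridors L w (((Js n).image fun x => x + τ n).image (boxIndex L))),
              Jc / (Real.cosh (θ * max (w : ℝ) (distToRegion ((((Js n).image fun x => x + τ n).image (boxIndex L)).biUnion (box L)) y)) - 1) *
                (1 + distToRegion ((Is n).image fun x => x + τ n) y) ^ 2) / 2))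
          + (∑ m ∈ (((Js n).image fun x => x + τ n).image (boxIndex L)),
              (2 * (2 ^ ((t + 1).choose 2) * (4 * (s1Const s D d κ * Ac * bs n ^ D * (L : ℝ) ^ d)) ^ (t + 1) / (t + 1)!) +
                    Real.exp (2 * (4 * (s1Const s D d κ * Ac * bs n ^ D * (L : ℝ) ^ d))) *
                      (3 * (((shrink L m w).card : ℝ) * Real.exp (-(bs n ^ 2 / 4)))) +
                    ∑ k ∈ Finset.range t,
                      (3 ^ (k + 1) * ((∑ π ∈ setPartitions (univ : Finset (Fin (k + 1))), ((π.card - 1)! : ℝ)) *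
                          (s1Const s D d κ * Ac * bs n ^ D * Real.exp (-(κ / 4 * v)) * (L : ℝ) ^ d *
                            (4 * (s1Const s D d κ * Ac * bs n ^ D * (L : ℝ) ^ d)) ^ k)) +
                        3 ^ (k + 1) * (2 ^ (k + 1) * ((∑ π ∈ setPartitions (univ : Finset (Fin (k + 1))), ((π.card - 1)! : ℝ)) *
                            ((min 1 (2 * ((shrink L m w).card : ℝ) * Real.exp (-(bs n ^ 2 / 4)))) ^ ((2 * (k + 1) : ℕ) : ℝ)⁻¹ *
                              ((1 + ((1 + V * M / (γA - Jc)) * (γ * bs n))) ^ D * (Ac * (L : ℝ) ^ d * ∑ p ∈ Finset.Icc 1 s, ((admissible p D).card : ℝ) *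
              ((2 / (1 - Real.exp (-(κ / 2 / (p : ℕ) / Real.sqrt d))) * Real.exp (κ / 2 / (p : ℕ) / Real.sqrt d)) ^ d) ^ (p - 1)) * momentConst D (2 * (k + 1)) ((max (max 1 (1 / (γA - Jc))) ((1 + V * M / (γA - Jc)) * (γ * bs n)))).toNNReal) ^ (k + 1))) +
                          2 ^ ((k + 1) * D) * 2 ^ 2 ^ ((k + 1) * D) * (max (max 1 (1 / (γA - Jc))) ((1 + V * M / (γA - Jc)) * (γ * bs n))) ^ ((k + 1) * D) * Real.exp (-(δ / 2 * ((v : ℝ) + 1))) *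
                            (Ac * Real.exp (δ / 2 * ((D : ℝ) ^ 2 * d)) * (L : ℝ) ^ d * ∑ p ∈ Finset.Icc 1 s, ((admissible p D).card : ℝ) *
              ((2 / (1 - Real.exp (-((κ / 2 - δ / 2 * ((D : ℝ) ^ 2 * Real.sqrt d)) / (p : ℕ) / Real.sqrt d))) *
                Real.exp ((κ / 2 - δ / 2 * ((D : ℝ) ^ 2 * Real.sqrt d)) / (p : ℕ) / Real.sqrt d)) ^ d) ^ (p - 1)) ^ (k + 1)) +
                        3 ^ (k + 1) * (2 ^ (k + 1) * ((∑ π ∈ setPartitions (univ : Finset (Fin (k + 1))), ((π.card - 1)! : ℝ)) *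
                            ((min 1 (2 * ((shrink L m w).card : ℝ) * Real.exp (-(bs n ^ 2 / 4)))) ^ ((2 * (k + 1) : ℕ) : ℝ)⁻¹ *
                              ((1 + ((1 + V * M / (γA - Jc)) * (γ * bs n))) ^ D * (Ac * (L : ℝ) ^ d * ∑ p ∈ Finset.Icc 1 s, ((admissible p D).card : ℝ) *
              ((2 / (1 - Real.exp (-(κ / 2 / (p : ℕ) / Real.sqrt d))) * Real.exp (κ / 2 / (p : ℕ) / Real.sqrt d)) ^ d) ^ (p - 1)) * momentConst D (2 * (k + 1)) ((max (max 1 (1 / (γA - Jc))) ((1 + V * M / (γA - Jc)) * (γ * bs n)))).toNNReal) ^ (k + 1))) +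
                          (Ac * (L : ℝ) ^ d * ∑ p ∈ Finset.Icc 1 s, ((admissible p D).card : ℝ) *
              ((2 / (1 - Real.exp (-(κ / 2 / (p : ℕ) / Real.sqrt d))) * Real.exp (κ / 2 / (p : ℕ) / Real.sqrt d)) ^ d) ^ (p - 1)) ^ (k + 1) * (2 ^ ((k + 1) * D) * 2 ^ 2 ^ ((k + 1) * D) *
                            ((((k + 1) * D : ℕ) : ℝ) * (max (max 1 (1 / (γA - Jc))) ((1 + V * M / (γA - Jc)) * (γ * bs n))) ^ ((k + 1) * D) * ((V₂ * M₂ / (γA - Jc) ^ 2 * Real.exp (-(θ / 2 * ((w - v : ℕ) : ℝ))) + Real.exp (-(θ * ((w - v : ℕ) : ℝ))) / (γA - Jc)) + M₂ / (γA - Jc) * (γ * bs n) * (1 + Real.sqrt d * ((L : ℝ) - 1)) * V₄ * Real.exp (-(θ / 4 * ((w - v : ℕ) : ℝ)))))))) / (k + 1)!) +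
            ∑ k ∈ Finset.range t,
          ((2 ^ (k + 1) * (2 ^ ((k + 1) * D) * 2 ^ 2 ^ ((k + 1) * D) * (max (max 1 (1 / (γA - Jc))) ((1 + V * M / (γA - Jc)) * (γ * bs n))) ^ ((k + 1) * D)) *
          ((Ac * Real.exp (δ / 2 * ((D : ℝ) ^ 2 * d)) *
              Real.exp (-((κ / 2 - δ / 2 * ((D : ℝ) ^ 2 * Real.sqrt d)) / 2 * w))) * ((Js n).image fun x => x + τ n).card *
            ∑ p ∈ Finset.Icc 1 s, ((admissible p D).card : ℝ) *
              ((2 / (1 - Real.exp (-((κ / 2 - δ / 2 * ((D : ℝ) ^ 2 * Real.sqrt d)) / 2 / (p : ℕ) / Real.sqrt d))) *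
                Real.exp ((κ / 2 - δ / 2 * ((D : ℝ) ^ 2 * Real.sqrt d)) / 2 / (p : ℕ) / Real.sqrt d)) ^ d) ^ (p - 1)) *
          (Ac * Real.exp (δ / 2 * ((D : ℝ) ^ 2 * d)) *
            ((1 : ℝ) * (2 / (1 - Real.exp (-(δ / (2 * ((k + 1 : ℕ) : ℝ)) / Real.sqrt d))) * Real.exp (δ / (2 * ((k + 1 : ℕ) : ℝ)) / Real.sqrt d)) ^ d) *
            ∑ p ∈ Finset.Icc 1 s, ((admissible p D).card : ℝ) *
              ((2 / (1 - Real.exp (-((κ / 2 - δ / 2 * ((D : ℝ) ^ 2 * Real.sqrt d)) / (p : ℕ) / Real.sqrt d))) *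
                Real.exp ((κ / 2 - δ / 2 * ((D : ℝ) ^ 2 * Real.sqrt d)) / (p : ℕ) / Real.sqrt d)) ^ d) ^ (p - 1)) ^ k
          + 2 ^ (k + 1) * (2 ^ ((k + 1) * D) * 2 ^ 2 ^ ((k + 1) * D) * (max (max 1 (1 / (γA - Jc))) ((1 + V * M / (γA - Jc)) * (γ * bs n))) ^ ((k + 1) * D)) *
        ((((Js n).image fun x => x + τ n).image (boxIndex L)).card * (Ac * Real.exp (δ / 2 * ((D : ℝ) ^ 2 * d)) * Real.exp (-((κ / 2 - δ / 2 * ((D : ℝ) ^ 2 * Real.sqrt d)) / 2 * v)) *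
          (L : ℝ) ^ d * ∑ p ∈ Finset.Icc 1 s, ((admissible p D).card : ℝ) *
              ((2 / (1 - Real.exp (-((κ / 2 - δ / 2 * ((D : ℝ) ^ 2 * Real.sqrt d)) / 2 / (p : ℕ) / Real.sqrt d))) *
                Real.exp ((κ / 2 - δ / 2 * ((D : ℝ) ^ 2 * Real.sqrt d)) / 2 / (p : ℕ) / Real.sqrt d)) ^ d) ^ (p - 1))) *
        (Ac * Real.exp (δ / 2 * ((D : ℝ) ^ 2 * d)) *
          (2 / (1 - Real.exp (-(δ / (2 * ((k + 1 : ℕ) : ℝ)) / Real.sqrt d))) * Real.exp (δ / (2 * ((k + 1 : ℕ) : ℝ)) / Real.sqrt d)) ^ d *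
          ∑ p ∈ Finset.Icc 1 s, ((admissible p D).card : ℝ) *
              ((2 / (1 - Real.exp (-((κ / 2 - δ / 2 * ((D : ℝ) ^ 2 * Real.sqrt d)) / (p : ℕ) / Real.sqrt d))) *
                Real.exp ((κ / 2 - δ / 2 * ((D : ℝ) ^ 2 * Real.sqrt d)) / (p : ℕ) / Real.sqrt d)) ^ d) ^ (p - 1)) ^ k)
          + (2 ^ (k + 1) * (2 ^ ((k + 1) * D) * 2 ^ 2 ^ ((k + 1) * D) * (max (max 1 (1 / (γA - Jc))) ((1 + V * M / (γA - Jc)) * (γ * bs n))) ^ ((k + 1) * D)) *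
          (Ac * Real.exp (δ / 2 * ((D : ℝ) ^ 2 * d)) * Real.exp (-((κ / 2 - δ / 2 * ((D : ℝ) ^ 2 * Real.sqrt d)) / 2 * w)) *
            (corridorsBar L w v (((Js n).image fun x => x + τ n).image (boxIndex L))).card * ∑ p ∈ Finset.Icc 1 s, ((admissible p D).card : ℝ) *
              ((2 / (1 - Real.exp (-((κ / 2 - δ / 2 * ((D : ℝ) ^ 2 * Real.sqrt d)) / 2 / (p : ℕ) / Real.sqrt d))) *
                Real.exp ((κ / 2 - δ / 2 * ((D : ℝ) ^ 2 * Real.sqrt d)) / 2 / (p : ℕ) / Real.sqrt d)) ^ d) ^ (p - 1)) *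
          (Ac * Real.exp (δ / 2 * ((D : ℝ) ^ 2 * d)) *
            (2 / (1 - Real.exp (-(δ / (2 * ((k + 1 : ℕ) : ℝ)) / Real.sqrt d))) * Real.exp (δ / (2 * ((k + 1 : ℕ) : ℝ)) / Real.sqrt d)) ^ d *
            ∑ p ∈ Finset.Icc 1 s, ((admissible p D).card : ℝ) *
              ((2 / (1 - Real.exp (-((κ / 2 - δ / 2 * ((D : ℝ) ^ 2 * Real.sqrt d)) / (p : ℕ) / Real.sqrt d))) *
                Real.exp ((κ / 2 - δ / 2 * ((D : ℝ) ^ 2 * Real.sqrt d)) / (p : ℕ) / Real.sqrt d)) ^ d) ^ (p - 1)) ^ k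
          + 2 ^ (k + 1) * (2 ^ ((k + 1) * D) * 2 ^ 2 ^ ((k + 1) * D) * (max (max 1 (1 / (γA - Jc))) ((1 + V * M / (γA - Jc)) * (γ * bs n))) ^ ((k + 1) * D)) *
        ((((Js n).image fun x => x + τ n).image (boxIndex L)).card * (Ac * Real.exp (δ / 2 * ((D : ℝ) ^ 2 * d)) * Real.exp (-((κ / 2 - δ / 2 * ((D : ℝ) ^ 2 * Real.sqrt d)) / 2 * v)) *
          (L : ℝ) ^ d * ∑ p ∈ Finset.Icc 1 s, ((admissible p D).card : ℝ) *
              ((2 / (1 - Real.exp (-((κ / 2 - δ / 2 * ((D : ℝ) ^ 2 * Real.sqrt d)) / 2 / (p : ℕ) / Real.sqrt d))) *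
                Real.exp ((κ / 2 - δ / 2 * ((D : ℝ) ^ 2 * Real.sqrt d)) / 2 / (p : ℕ) / Real.sqrt d)) ^ d) ^ (p - 1))) *
        (Ac * Real.exp (δ / 2 * ((D : ℝ) ^ 2 * d)) *
          (2 / (1 - Real.exp (-(δ / (2 * ((k + 1 : ℕ) : ℝ)) / Real.sqrt d))) * Real.exp (δ / (2 * ((k + 1 : ℕ) : ℝ)) / Real.sqrt d)) ^ d *
          ∑ p ∈ Finset.Icc 1 s, ((admissible p D).card : ℝ) *
              ((2 / (1 - Real.exp (-((κ / 2 - δ / 2 * ((D : ℝ) ^ 2 * Real.sqrt d)) / (p : ℕ) / Real.sqrt d))) *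
                Real.exp ((κ / 2 - δ / 2 * ((D : ℝ) ^ 2 * Real.sqrt d)) / (p : ℕ) / Real.sqrt d)) ^ d) ^ (p - 1)) ^ k)
          + 2 ^ ((k + 1) * D) * 2 ^ 2 ^ ((k + 1) * D) * (max (max 1 (1 / (γA - Jc))) ((1 + V * M / (γA - Jc)) * (γ * bs n))) ^ ((k + 1) * D) *
        ((((Js n).image fun x => x + τ n).image (boxIndex L)).card * (((k + 1 : ℕ) : ℝ) * (k : ℝ) *
          ((Ac * Real.exp (δ / 2 * ((D : ℝ) ^ 2 * d)) * ((L : ℝ) ^ d * (2 / (1 - Real.exp (-(δ / (2 * ((k + 1 : ℕ) : ℝ)) / Real.sqrt d))) * Real.exp (δ / (2 * ((k + 1 : ℕ) : ℝ)) / Real.sqrt d)) ^ d) *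
              ∑ p ∈ Finset.Icc 1 s, ((admissible p D).card : ℝ) *
              ((2 / (1 - Real.exp (-((κ / 2 - δ / 2 * ((D : ℝ) ^ 2 * Real.sqrt d)) / (p : ℕ) / Real.sqrt d))) *
                Real.exp ((κ / 2 - δ / 2 * ((D : ℝ) ^ 2 * Real.sqrt d)) / (p : ℕ) / Real.sqrt d)) ^ d) ^ (p - 1)) * ((Ac * Real.exp (δ / 2 * ((D : ℝ) ^ 2 * d)) * Real.exp (-(δ / (2 * ((k + 1 : ℕ) : ℝ)) / 2 * ((w : ℝ) + v + 1))) * ((L : ℝ) ^ d * (2 / (1 - Real.exp (-(δ / (2 * ((k + 1 : ℕ) : ℝ)) / 2 / Real.sqrt d))) * Real.exp (δ / (2 * ((k + 1 : ℕ) : ℝ)) / 2 / Real.sqrt d)) ^ d) *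
              ∑ p ∈ Finset.Icc 1 s, ((admissible p D).card : ℝ) *
              ((2 / (1 - Real.exp (-((κ / 2 - δ / 2 * ((D : ℝ) ^ 2 * Real.sqrt d)) / (p : ℕ) / Real.sqrt d))) *
                Real.exp ((κ / 2 - δ / 2 * ((D : ℝ) ^ 2 * Real.sqrt d)) / (p : ℕ) / Real.sqrt d)) ^ d) ^ (p - 1)) *
             (Ac * Real.exp (δ / 2 * ((D : ℝ) ^ 2 * d)) * ((L : ℝ) ^ d * (2 / (1 - Real.exp (-(δ / (2 * ((k + 1 : ℕ) : ℝ)) / Real.sqrt d))) * Real.exp (δ / (2 * ((k + 1 : ℕ) : ℝ)) / Real.sqrt d)) ^ d) *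
              ∑ p ∈ Finset.Icc 1 s, ((admissible p D).card : ℝ) *
              ((2 / (1 - Real.exp (-((κ / 2 - δ / 2 * ((D : ℝ) ^ 2 * Real.sqrt d)) / (p : ℕ) / Real.sqrt d))) *
                Real.exp ((κ / 2 - δ / 2 * ((D : ℝ) ^ 2 * Real.sqrt d)) / (p : ℕ) / Real.sqrt d)) ^ d) ^ (p - 1)) ^ (k - 1)))))
          + (((Js n).image fun x => x + τ n).image (boxIndex L)).card * ((3 : ℝ) ^ (k + 1) *
        (2 ^ ((k + 1) * D) * 2 ^ 2 ^ ((k + 1) * D) * (max (max 1 (1 / (γA - Jc))) ((1 + V * M / (γA - Jc)) * (γ * bs n))) ^ ((k + 1) * D) *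
            Real.exp (-(δ / 2 * ((v : ℝ) + 1))) *
          (Ac * Real.exp (δ / 2 * ((D : ℝ) ^ 2 * d)) * (L : ℝ) ^ d * ∑ p ∈ Finset.Icc 1 s, ((admissible p D).card : ℝ) *
              ((2 / (1 - Real.exp (-((κ / 2 - δ / 2 * ((D : ℝ) ^ 2 * Real.sqrt d)) / (p : ℕ) / Real.sqrt d))) *
                Real.exp ((κ / 2 - δ / 2 * ((D : ℝ) ^ 2 * Real.sqrt d)) / (p : ℕ) / Real.sqrt d)) ^ d) ^ (p - 1)) ^ (k + 1)))) / (k + 1)!))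
        + (Is 0).card * (4 * 8 ^ d * Real.exp (-(bs m ^ 2 / (2 * (1 / γA))))) ≤ E := by
  refine le_trans ?_ hpack
  refine add_le_add (Finset.sum_le_sum fun n hn => ?_) (mul_le_mul_of_nonneg_right hI (by positivity))
  have hn' := Finset.mem_range.mp hn
  exact step_geometric_le_nI hκ0 hδ0 hκ' hA hθ hJc0 hγA0 hJcγ hV hM hV₂ hM₂ hV₄ hγ0 (hb0 n hn') hL hL1 hw hW1 hW2 (hJne n hn')
    (hJI n hn') (hJcard n hn')

end Literature.MathematicalPhysics.QuantumFieldTheory.Balaban1983to89.B1Eq324BenfattoKernelSect5LedgerBridge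

end
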